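import Mathlib
import HarnessLib
import HarnessLib.Audit
import Summits.BirchSwinnertonDyer.Statement
import Summits.BirchSwinnertonDyer.Rank1Residual.WAll.TargetAdditiveAtThreeCells
import Summits.BirchSwinnertonDyer.Rank1Residual.WAll.TargetAdditiveAtThreePotSSImage
import Summits.BirchSwinnertonDyer.BirchSwinnertonDyer.Theorems.SchneiderFreeAdditiveX3Defs
import Summits.BirchSwinnertonDyer.BirchSwinnertonDyer.Theorems.SchneiderFreeSockets
import Literature.NumberTheory.EllipticCurves.NonvanishingTwistsPrescribedSplitting
import Literature.NumberTheory.EllipticCurves.LiuZhangZhang2018.PAdicWaldspurgerEllipticCurveAdditive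
import Literature.NumberTheory.EllipticCurves.Hsieh2014.AnticyclotomicPAdicLFunctionAnyLevel
import Literature.NumberTheory.EllipticCurves.BDPCentralValueReciprocity
import Literature.NumberTheory.EllipticCurves.CastellaGrossiLeeSkinner2022.ResidualCharacterSelmerFinite
import Literature.NumberTheory.EllipticCurves.KellerYin2024.AnomalousLambdaInvariants
import Summits.BirchSwinnertonDyer.BirchSwinnertonDyer.Theorems.UniversalToricDescentToricPublishedInputsGlue
import HarnessLib.Audit.Status.Attr

/-!
Route: CumulativeHeegnerLeopoldt

# Route CumulativeHeegnerLeopoldt — Cumulative Heegner classes in Leopoldt coordinates - BSD_3 at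
rank one for wild additive 3 with reducible E[3] on the non-anomalous line, via a tempered
anticyclotomic main conjecture

It suffices to show X = X_cell ∧ X_res on the loaded W-ALL leaf `WAllExclAddWildRankOne` (Block A:
non-CM E/ℚ, wild additive at 3 (`ClassO6`, e ∈ {6,12}, a₃ = 0), r_an = 1; 13 573 isogeny classes).
X_cell (the thesis proper; 2 666 classes = census KL-LOCUS (1), inside the 9 376-class
reducible-E[3] sub-leaf `WAllExclAddWildRankOneRed` that today is only the bare aside 20388 of
UniversalToricDescent): on the LEOPOLDT CELL — E[3] reducible and its rational 3-isogeny line Φ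
non-anomalous at 3 (the decomposition group at 3 neither fixes Φ pointwise nor acts trivially on
E[3]/Φ, typed in the Galois form of `Barriers/AnomalousHeegnerLogWall`) — BSD₃(E) follows from four
statements over a Heegner field K with 3 split and the classical Heegner hypothesis: K1
`CumulativeHeegnerInclusionAtThree` (span{ℒ_𝔭^BDP} ⊆ char X_{∅,0}: the Heegner-side divisibility, to
be proved with the CUMULATIVE Heegner class κ♮ = (3^{-m} Σ_{k≤m} y_{3^k})_m, which is
norm-compatible because a₃ = 0 forces Tr y_{3^{k+1}} = 0, read in the Leopoldt coordinates of the
local points Ê(K_{m,𝔓}) ≅ 𝔾̂_a(𝔪) = ring of integers over its associated order), K2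
`EisensteinCharacterInvariantsAtThree` (char X_{∅,0} principal with the same λ-invariant as ℒ_𝔭 and
μ = 0 on both sides: the Eisenstein comparison with the two characters of E[3]), K3
`WildSplitFrameAtThree` (the BDP/Hsieh measure exists at additive 3; shared verbatim with UTD
20928), K4 `RedSplitControlAtThree` (anticyclotomic control at the trivial character on the cell);
plus the rank-zero partner K5 `WildRankZeroTwistAtThree` (= `WAllExclAddWildRankZero`, residual
shared with UTD 20387) through the image-free exact-index identity
`bsdp_of_exactIndexManin_of_partner_bsdp`. X_res = K6 `WildRankOneOffLeopoldtCellAtThree`: the wild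
r1 rows off the cell — the 4 197 irreducible-E[3] classes (the leaves of UTD/SOED/CU and the 303
twins, owned there) and the 6 710 reducible anomalous-line classes (behind
`AnomalousHeegnerLogWall`, unowned) — declared residual so the leaf is decided.
Lean: `Summit.BirchSwinnertonDyer.WAllExclAddWildRankOne`

## Assembly
Pure logic: `closes` splits a wild r1 row on the predicate (E[3] reducible ∧ Leopoldt cell); on the
cell the kernel support consumes the published inputs, LZZ, K1–K5; off the cell K6 is the declared
residual. Every crux is a binder of `closes` and is consumed.

CLOSES_TARGET: closes rung W-ALL/2@3.WildRankOne of BirchSwinnertonDyer: Summit.BirchSwinnertonDyer.WAllExclAddWildRankOne (D-0061; not the summit Statement) — the deciding theorem of this route concludes that registered leaf instead of the Statement decl `BirchSwinnertonDyer` (class rung: servable and labelled, never counted as concluding the summit Statement).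

Rationale: WHY THIS LINE. Transfer (lens) from the solved sibling "rank-one BSD_p at an Eisenstein GOOD
ORDINARY p" (Castella–Grossi–Lee–Skinner Invent. 2022 / Castella–Grossi–Skinner 2025, tree
`Literature.NumberTheory.EllipticCurves.CastellaGrossiSkinner2025.*`: Thm 6.5.2 Howard divisibility
in Λ[1/p] under E(K)[p] = 0, Thm 6.5.3 equality for φ|G_p ∉ {1,ω}) to wild additive p = 3, step by
step: the character comparison (K2) and the non-anomalous hypothesis transfer verbatim; the FIRST
NON-TRANSFERRING STEP is the Λ-adic Heegner class κ_∞ — at additive 3, a₃ = 0 makes the Heegner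
points of 3-power conductor TRACE-ZERO (`TraceZeroHeegnerTowerAtAdditiveSplitP`, pss3 g3 Barriers
§1), so no norm-compatible bounded class exists. The new lever repairs exactly that step: the
cumulative sums y♮_m = Σ_{k≤m} y_{3^k} satisfy Tr y♮_{m+1} = 3·y♮_m, so κ♮ := (3^{-m} y♮_m)_m IS
norm-compatible (a (1/2)-tempered class with κ♮(𝟙) = y_K and κ♮(χ) = 3^{-n}·(χ-resolvent of y_{3^n})
for χ of exact conductor 3^n), and the local points that receive it are, because Ê ≅ 𝔾̂_a over ℤ₃ at
an additive prime (tree theorems `Additive.formalMul_prime_map_eq_zero_of_addv`,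
`Additive.norm_coeff_formalLog_baseChange_le_one_of_addv`), literally the additive Galois module
𝔪_{K_{m,𝔓}}, whose structure over ℤ₃[G_m] is Leopoldt's theorem in Lettl's local form
(doi:10.4064/aa-85-3-235-248, Thm 1, p ≥ 3: 𝒪_N ≅ ℤ₃[Γ] ⊗_{ℤ₃[Γ₀]} 𝔐₀, maximal order on the inertia
part) — every ramification level is its own "sign", replacing Kobayashi–Pollack ± (good
supersingular, p ∤ N: Castella–Wan, Büyükboduk–Lei arXiv:1605.05310) where no Wach module exists (p²
∣ N). Imported areas: integral Galois module theory (Leopoldt/Lettl associated orders) and tempered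
Iwasawa theory (Perrin-Riou) into the Heegner-point main conjecture; p-adic Waldspurger at additive
primes (Liu–Zhang–Zhang 2018, shared support) supplies the bottom value. What it does that prior
routes do not: UTD/SOED/CU need E[3] onto or irreducible (transport, Eisenstein-ideal-free
Kolyvagin), K9's PR^×₃ is cyclotomic and type-blind, SchneiderFreeAdditiveX3 is potentially-ORDINARY
only (its header: no format at e ∈ {3,4,6}); no route, card or negatives entry uses
cumulative/tempered Heegner classes or the 𝔾_a/Leopoldt structure of local points at a bad prime.

RANKED CRUXES. #2 CumulativeHeegnerInclusionAtThree (crux) — On the Leopoldt cell (wild additive 3,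
E[3] reducible with non-anomalous rational line, r_an = 1), over a Heegner field K with 3 = 𝔭𝔭̄
split and the classical Heegner hypothesis, for every anticyclotomic ℤ₃-extension, topological
generator, branch ι′ inducing 𝔭 and BDP-type measure L at 𝔭: span{L} ⊆ (char_Λ X_{∅,0} at 𝔭′) mapped
to Λ^ur — the Heegner-side divisibility, to be proved by the cumulative-class Kolyvagin argument
(first lemma: the cumulative resolvent identity Tr y♮_{m+1} = 3 y♮_m and κ♮ ∈ H¹ ⊗ ℚ₃
norm-compatible of temper 1/2; then Col♮ ∘ loc_𝔭 κ♮ ≐ ℒ_𝔭 via Lettl + LZZ; then the tempered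
Kolyvagin-system bound à la CGS Thm 6.5.2 with E(K)[3] = 0 on the cell, sharpened from Λ[1/3] to Λ
by the bottom-layer pin κ♮(𝟙) = y_K ∉ 3E(K) ⊗ unit). [deps: WildSplitFrameAtThree] [difficulty: XL]
(why it might fail: E[3] reducible: the Kolyvagin-system rigidity behind a FULL-Λ divisibility is
only known in Λ[1/p] for Eisenstein p (CGS 6.5.2) and tempered classes lose a further μ-power; the
bottom pin may not recover the 3-power on the 1 546 classes with E(ℚ)[3] ≠ 0.)
[doi:10.4064/aa-85-3-235-248, arXiv:1605.05310, CastellaGrossiSkinner2025, LiuZhangZhang2018,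
PerrinRiou1994]
#3 EisensteinCharacterInvariantsAtThree (crux) — Same frame: char_Λ X_{∅,0} (at 𝔭′, mapped to Λ^ur)
is principal, generated by some g, and g and the BDP measure L have μ = 0 and the SAME λ-invariant
(index of the first unit coefficient) — the Eisenstein comparison: both sides are computed from the
two characters φ, ψ = ωφ⁻¹ of E[3]^ss (Rubin's two-variable main conjecture for K at p = 3 on the
algebraic side; the BDP–Katz congruence ℒ_𝔭² ≡ L_𝔭^Katz(φ)·L_𝔭^Katz(ψ) mod the Eisenstein ideal and
Hida/Hsieh μ = 0 on the analytic side), the non-anomalous cell hypothesis killing the local error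
terms at 𝔭, 𝔭̄ exactly as φ|G_p ∉ {1, ω} does in CGLS. [deps: WildSplitFrameAtThree] [difficulty:
XL] (why it might fail: μ(ℒ_𝔭^BDP) = 0 at an additive Eisenstein p = 3 is open
(EisensteinMuConjecture scope; Hsieh's μ-theorem needs p ∤ N or (sur)), and the BDP–Katz congruence
at p² ∣ N has no printed proof; the 3-torsion of Tamagawa factors at additive primes ℓ ≠ 3 of K
enters λ(g).) [CastellaGrossiSkinner2025, Hsieh2014, arXiv:2405.00270, Rubin1991]
#4 WildSplitFrameAtThree (crux) — The frame exists at wild additive 3 (verbatim the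
UniversalToricDescent item 20928, shared by signature): for E of class O6 at 3 with conductor N, K
Heegner for N with 3 split, every anticyclotomic ℤ₃-extension/topological generator and prime 𝔭 over
3 there are a branch ι′ inducing 𝔭, periods Ω_K ≠ 0, Ω_p ≠ 0 and an unramified power series L that
is a BDP p-adic L-function for (f_E, 𝔭, κ, γ). [difficulty: L] (why it might fail: at p² ∣ N the
BDP/Hsieh interpolation (Hsieh 2014 any level is typed for p ∤ N in the tree's `IsHsiehLFunction`)
needs the additive local toric integral of LZZ Thm 1.5.3 to be a p-adic analytic family in the
anticyclotomic variable, which is printed only pointwise.) [Hsieh2014, LiuZhangZhang2018,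
arXiv:2410.23241]
#5 RedSplitControlAtThree (crux) — Anticyclotomic control at the trivial character on the Leopoldt
cell: for E, K, the Heegner point P = y_K of infinite order (r_an(E/K) = 1 with the twist value
non-zero) and Kolyvagin's theorem, the on-tree control statement
`SchneiderFree.AdditiveControlOnTreeAt 3 κ 𝔭 γ emb P` (the UTD control item with the onto-image
hypothesis replaced by reducible + non-anomalous line) — #Ш(E/K)[3^∞]·(index data) is read off
X_{∅,0} at T = 0, the local condition at 𝔭 ∣ 3 being Ê(𝔪) = 𝔪 (𝔾_a, finite cokernel by Lettl) and
E(K_𝔭)[3] = 0 on the cell. [deps: WildSplitFrameAtThree] [difficulty: L] (why it might fail: with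
E[3] reducible the control error at T = 0 picks up E(K)[3] and the 3-part of Tamagawa numbers at
additive ℓ ∣ N inert-free but possibly ramified in K(E[3]); UTD's proved control glue (p526934) used
surjectivity for local finiteness at 𝔭.) [Greenberg1999, JetchevSkinnerWan2017,
CastellaGrossiSkinner2025]
#6 WildRankZeroTwistAtThree (crux) — RESIDUAL (rank-zero partner, shared verbatim with UTD 20387 /
the leaf `WAllExclAddWildRankZero`): BSD₃ for non-CM curves of class O6 at 3 with r_an = 0 — used
for the twist E^(d_K); owned by the rank-zero cells (K9/W2), imported here by name. [difficulty:
open-problem] (why it might fail: it is itself 11 250 classes of open BSD₃ at rank zero with a₃ = 0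
(Kato's Euler system divisibility at additive 3 is known, the equality is not: no finite-slope
family through f_E).) [Kato2004, FouquetWan2021]
#7 WildRankOneOffLeopoldtCellAtThree (crux) — RESIDUAL (off-cell complement on the wild r1 leaf, 10
907 classes): BSD₃ for the wild-3, r_an = 1, non-CM curves NOT on the Leopoldt cell — i.e. E[3]
irreducible (4 197 classes: exactly the leaves `WAllExclAddWildRankOneSurj` of UTD/SOED/CU and
`WAllExclAddWildRankOneIrrNotSurj` of the UTD twin, owned there) or E[3] reducible with ANOMALOUS
rational line (6 710 classes, the natural target of a future Greenberg–Vatsal-type line; NB Kriz–Li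
2018 Thm 1.12 / 2019 Thm 7.1 assume hypothesis (1) ψ(3) ≠ 1 ∧ (ψ⁻¹ω)(3) ≠ 1 = NON-anomalous, so they
bear on the Leopoldt cell itself — K1's T = 0 / unit-log door, chl-k1-p1-w2 g7
LIT-SWEEP-ADDITIVE-w2g7 §5, p645092 — and NOT on this complement) — outside this thesis, recorded so
the leaf is decided. [difficulty: open-problem] (why it might fail: its reducible half contains the
1 546+ classes with a rational 3-torsion point and a₃ = 0, where even the Λ[1/p] Howard bound (CGS
6.5.2 needs E(K)[p] = 0) is unavailable and AnomalousHeegnerLogWall applies head-on; its irreducible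
half is three open routes deep.) [CastellaGrossiSkinner2025, GreenbergVatsal2000, KrizLi2019]
#9 ToricPublishedInputs (support) — The published-input conjunction shared verbatim with
UniversalToricDescent (Gross–Zagier, Kolyvagin, rank = analytic rank ≤ 1, entire L-function, modular
parametrisation, isogeny invariance of the BSD quotient, GZ I.7.3, Friedberg–Hoffstein twists with
prescribed splitting, parity, existence of Heegner points). [difficulty: provable-now]
[GrossZagier1986, Kolyvagin1990, FriedbergHoffstein1995]
#9 LiuZhangZhangAdditiveInput (support) — Liu–Zhang–Zhang 2018 Thms 1.5.1/1.5.3 for the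
modular-curve Heegner vector at an additive prime (the named Literature fact, shared with UTD
20316): the p-adic Waldspurger value ℒ_𝔭(𝟙) = (unit)·log²_ω(y_K) at split additive 3. [difficulty:
provable-now] [LiuZhangZhang2018]
#9 LeopoldtKernelAtThree (support) — The kernel on the Leopoldt cell: published inputs → LZZ → K1 →
K2 → K3 → K4 → K5 → BSD₃(E) for every wild-3, r_an = 1, E[3]-reducible E on the cell. Proof plan =
the SemiOrdinaryEisensteinDescent kernel verbatim with the image swapped: K1 + frame + LZZ value
(`wildSplitWaldspurgerAtThree_flat_forall`, image-free) + control ⇒ 2·ord₃[E(K):ℤy_K] ≥ ord₃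
#Ш(E/K)·(index data) (upper bound on Ш); K2 turns the inclusion into equality of ideals (same λ, μ =
0 ⇒ unit quotient) ⇒ the reverse inequality; exact index + Gross–Zagier + partner BSD₃(E^K) (K5) ⇒
BSD₃(E) by `bsdp_of_exactIndexManin_of_partner_bsdp` (any odd p ∣ N, image-free). [difficulty: L]
[GrossZagier1986, CastellaGrossiSkinner2025, LiuZhangZhang2018]

TWO-LAYER PLAN. K1 ⇐ (a) CumulativeClass: κ♮ norm-compatible of temper 1/2 with the specialisation
identities (group-ring identity + a₃ = 0 distribution relation; provable now) → (b)
LeopoldtReciprocity: Col♮(loc_𝔭 κ♮) = ℒ_𝔭 · unit in Λ^ur ⊗ ℚ (Lettl Thm 1 + LZZ at every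
finite-order character) → (c) TemperedKolyvaginBound: char X_{∅,0} ⊇ 3^{μ}·span{ℒ_𝔭} for some μ,
then μ = 0 from the bottom pin → K1. K2 ⇐ (a) algebraic two-character comparison (Rubin 1991 +
control of the φ-, ψ-Selmer groups, non-anomalous) → (b) analytic comparison (BDP–Katz congruence at
p² ∣ N + Hida μ = 0) → K2.

KILL CRITERIA. A refutation of K1 or K2 on ONE cell curve (e.g. a wild-3 r1 curve with reducible
E[3], non-anomalous line, where 2·ord₃[E(K):ℤy_K] ≠ ord₃(#Ш_an(E)·#Ш_an(E^K)·c-data) — i.e. BSD₃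
itself fails numerically, or where char X_{∅,0} is computed to have μ > 0) closes the route
`refuted:<Decl>`; a proof that κ♮ cannot be made (1/2)-tempered-integral (the cumulative resolvents
have unbounded denominators beyond 3^{m}) forces a pivot to the Eisenstein-only line (K2 +
Greenberg–Vatsal-type rank-0 anchor, predicted C by g3/g8) — effectively retirement; K3 refuted (no
BDP measure at p² ∣ N) kills this route AND UTD/SOED's frame. BSD₃ proved for all r_an ≤ 1 additive
curves elsewhere (K9's PR^×₃ + KMC₃) moots it.

NOT DECOMPOSED YET. The three K1 children and two K2 children above (layer 2, filed only when K3
closes or a prover asks); the exact form of the Leopoldt coordinate map Col♮ (a definition request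
once K3's L is in hand); the Tamagawa-at-additive-ℓ bookkeeping inside K4; the choice of K
(Friedberg–Hoffstein with 3 split and the twist value non-zero is inside the kernel, as in
UTD/SOED).

CHEAPEST FALSIFIER. Bottom-layer exactness on the cell, pair by pair: for the first twenty wild-3 r1
classes with reducible E[3] and non-anomalous line (census KL-LOCUS (1), e.g. conductor 27·M curves
with a 3-isogeny and a₃ = 0, φ|G₃ ∉ {1,ω}), a Heegner K with 3 split, compute y_K, [E(K):ℤy_K],
#Ш_an(E), #Ш_an(E^(d_K)), Tamagawa numbers and the Manin constant: ONE class with 2·ord₃[E(K):ℤy_K]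
≠ ord₃(#Ш_an(E)#Ш_an(E^K)) + 2·ord₃(c·∏c_ℓ) kills K1∧K2∧K4 on that class. Second, cheaper still and
in reach of a refuter with Magma: the cumulative trace identity Tr_{K[27]/K[9]} y_{27} = 0 and y♮
integrality for one cell curve (e.g. 27a-type twists are CM — take a non-CM N = 27·M example). Not
run here (kit_allowed = false); filed as a census ask.

NUMBERS. Leaf `WAllExclAddWildRankOne` 13 573 classes; reducible sub-leaf 9 376 (W-ALL census
ROW2-AT3-SUBBLOCKS-v1); Leopoldt cell = KL-LOCUS (1) 2 666 (28 % of the reducible sub-leaf, 20 % of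
the leaf); off-cell residual 10 907 = 4 197 irreducible (owned by UTD/SOED/CU/twin) + 6 710
reducible-anomalous; rational 3-torsion sub-block 1 546 (inside the off-cell part when the torsion
point spans Φ and D₃ fixes it — anomalous by definition) [census-g8/KL-LOCUS-v1]. Temper of κ♮:
1/2·(1 + 1/3 + …) ≤ 1 power of 3 per layer (v₃(3^{-m}) = −m against [K_m:K] = 3^m·h). Lettl: index
[𝒪_N : 𝔐·T] = 1 for N/ℚ₃ abelian, p = 3 ≥ 3 allowed.

DEFINITION REQUESTS. None at open. Foreseen (layer 2): `LeopoldtCoordinate` (the Col♮ map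
H¹_f(K_{m,𝔓}, T₃E) → ℤ₃[G_m] ⊗ 𝔐₀ given by Lettl's generator), topic
Summits/BirchSwinnertonDyer/BirchSwinnertonDyer/Theorems; cite facts wanted: `fact: Lettl 1998 Thm
1` (Literature/NumberTheory/GaloisModules), `fact: Perrin-Riou tempered distributions h-admissible
uniqueness` (exists in part as `Literature.NumberTheory.PAdicLFunctions.*`?).

Novelty: Searches (2026-08-28): `lit search --hybrid "Leopoldt theorem ring of integers associated order
abelian field generator roots of unity"` (6 docs: Lang Cyclotomic Fields pp.116–120, textbooks);
`lit search --hybrid "Lettl Galois module structure local fields absolutely abelian associated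
order"` (5); `lit search "Lettl absolutely abelian local Galois module" --source all` (local 5:
doi:10.4064/aa-85-3-235-248 HELD, read p.236 Thm 1 and p.13; doi:10.1006/jnth.1999.2385 p.2;
external APIs 429); `lit vsearch "Heegner points along the anticyclotomic tower are not norm
compatible when a_p = 0; plus and minus Heegner classes"` (8, off-topic textbooks); `lit search
--hybrid "anticyclotomic Iwasawa main conjecture additive reduction at p supercuspidal Heegner
points"` (8: Silverman, Cornell–Silverman–Stevens, Delbourgo, arXiv:2407.11891 Castella TNC for CM);
`lit vsearch "Kolyvagin system built from unbounded (tempered) classes gives divisibility … up to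
powers of p"` (6, textbooks); `lit search --hybrid "Eisenstein prime anticyclotomic Selmer group
comparison characters lambda mu invariants rank one"` (6: arXiv:2405.00270 BCS base change); `lit
search "Castella Wan Perrin-Riou main conjecture supersingular Heegner plus minus" --source all`
(local 6: arXiv:2310.06813 p.3, 1806.07214 p.46, 1605.05310 p.36, 2203.14164); `lit search
"Burungale Kobayashi Ota Rubin conjecture local units anticyclotomic"` (arXiv:2401.09037,
2304.09806); `lit read paper:arxiv-1605.05310 --grep` (p.3 L11 "We  [refs: 10.4064/aa-85-3-235-248, 10.1006/jnth.1999.2385, 2407.11891, 2405.00270, 2310.06813, 2401.09037, 1605.05310, doi:10.4064/aa-85-3-235-248, doi:10.1006/jnth.1999.2385, paper:arxiv-1605.05310, CastellaGrossiSkinner2025]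

Barriers (technique_class: anticyclotomic-iwasawa, heegner, galois-module, eisenstein): - technique_class: anticyclotomic-iwasawa, heegner, galois-module, eisenstein
- Literature.Barriers.BirchSwinnertonDyer.AnomalousHeegnerLogWall: outside by construction — the
cell hypothesis is the typed negation of the wall's anomalous condition (decomposition group at 3
fixes the line or acts trivially on the quotient); the 6 710 anomalous classes are the declared
residual K6, not attacked.
- Literature.Barriers.BirchSwinnertonDyer.ReducibleAnticyclotomicAtBadP: inside its scope (reducible
E[p] at a bad p) for K1/K2/K4; evasion = the barrier's recorded caveat: its obstruction is the
absence of an ordinary/± local condition at p ∣ N, and here the local condition at 𝔭 ∣ 3 is the full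
𝔾_a-group Ê(𝔪) = 𝔪 with Lettl's explicit Galois structure (no ordinary filtration, no signs needed);
it does not evade the missing full-Λ Kolyvagin rigidity for reducible E[3] — the bet is E(K)[3] = 0
on the cell + the bottom-layer pin (K1's why-might-fail).
- Literature.Barriers.BirchSwinnertonDyer.EisensteinMuBarrier: it does not evade it for K2; the bet
is that μ(ℒ_𝔭^BDP) = 0 at additive 3 follows from the Katz-product congruence and Hida's μ = 0 for
the two CM-character L-functions (finite-order characters of 3-power conductor, Hsieh 2014 any
level), as in CGLS §3 — named as K2's why-might-fail.
- Literature.Barriers.BirchSwinnertonDyer.EulerSystemBigImageBarrier: inside for K1 (E[3] reducible,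
no big image): conceded; the Kolyvagin-system argument is run Howard/CGS-style with the weaker hypo

History (route lifecycle, newest last):
- 2026-08-28T02:33:35Z · rev 2: restated LeopoldtKernelAtThree (stmt-BirchSwinnertonDyer-24202) — repair: 24202 misstated (CM j=0 rows); C′ inserts ¬W.HasCM; kernel body = p596253 (director-bsd (142)(a)) (operator:999:620599)
- 2026-08-28T15:57:29Z · rev 6: informal re-worded for WildRankOneOffLeopoldtCellAtThree (planner-bsd-wall-pss3-g20-0)
- 2026-08-29T02:47:02Z · rev 9: informal re-worded for EisensteinCharacterInvariantsAtThreeOdd (planner-bsd-wall-pss3-g21-0)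
- 2026-08-31T02:11:00Z · RESIDUAL declared: WildRankZeroTwistAtThree (stmt-BirchSwinnertonDyer-20387) — summit-strength until shown otherwise: D-0170(1) declared residual of CHL (imported rank-zero twist complement of a rank-one Heegner–Leopoldt route; tribunal_f (planner-bsd-wall-pss3-g27-0)

sub-problem: BirchSwinnertonDyer · status: open · opened planner-bsd-wall-pss3-g10-0 2026-08-28T00:41:02Z · rev 11 · ledger route-BirchSwinnertonDyer-CumulativeHeegnerLeopoldt
GENERATED by the gate from the ledger (D-0016/17). Provers cite these decls: `theorem foo : Summit.BirchSwinnertonDyer.BirchSwinnertonDyer.Theses.CumulativeHeegnerLeopoldt.<Decl> := …` in Summits/BirchSwinnertonDyer/BirchSwinnertonDyer/Theorems/<Name>.lean.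
-/

namespace Summit.BirchSwinnertonDyer.BirchSwinnertonDyer.Theses.CumulativeHeegnerLeopoldt

open scoped BigOperators Topology Manifold Classical MeasureTheory ProbabilityTheory Matrix InnerProductSpace ComplexConjugate ContinuousMap
open Filter Set Function TopologicalSpace MeasureTheory

attribute [summit_statement] _root_.BirchSwinnertonDyer
attribute [summit_statement] _root_.Summit.BirchSwinnertonDyer.WAllExclAddWildRankOne

open Literature

/-- item stmt-BirchSwinnertonDyer-24198 · crux · rank 2 · SPLIT (gen 1) into TemperedHeegnerInclusionAtThree, ResidualSelmerPrintedInputAtThree, ResidualSelmerFiniteAtThreeOfPrint + glue CumulativeHeegnerInclusionAtThreeGlue · direct attempts still welcome (low priority) · by planner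
why it might fail: E[3] reducible: the Kolyvagin-system rigidity behind a FULL-Λ divisibility is only known in Λ[1/p] for Eisenstein p (CGS 6.5.2) and tempered classes lose a further μ-power; the bottom pin may not recover the 3-power on the 1 546 classes with E(ℚ)[3] ≠ 0.
sources: doi:10.4064/aa-85-3-235-248, arXiv:1605.05310, CastellaGrossiSkinner2025, LiuZhangZhang2018, PerrinRiou1994
[crux] On the Leopoldt cell (wild additive 3, E[3] reducible with non-anomalous rational line, r_an
= 1), over a Heegner field K with 3 = 𝔭𝔭̄ split and the classical Heegner hypothesis, for every
anticyclotomic ℤ₃-extension, topological generator, branch ι′ inducing 𝔭 and BDP-type measure L at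
𝔭: span{L} ⊆ (char_Λ X_{∅,0} at 𝔭′) mapped to Λ^ur — the Heegner-side divisibility, to be proved by
the cumulative-class Kolyvagin argument (first lemma: the cumulative resolvent identity Tr y♮_{m+1}
= 3 y♮_m and κ♮ ∈ H¹ ⊗ ℚ₃ norm-compatible of temper 1/2; then Col♮ ∘ loc_𝔭 κ♮ ≐ ℒ_𝔭 via Lettl + LZZ;
then the tempered Kolyvagin-system bound à la CGS Thm 6.5.2 with E(K)[3] = 0 on the cell, sharpened
from Λ[1/3] to Λ by the bottom-layer pin κ♮(𝟙) = y_K ∉ 3E(K) ⊗ unit). [deps: WildSplitFrameAtThree]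
[difficulty: XL] -/
@[route_item "route-BirchSwinnertonDyer-CumulativeHeegnerLeopoldt", crux]
def CumulativeHeegnerInclusionAtThree : Prop :=
  ∀ (W : WeierstrassCurve ℚ) [W.IsElliptic] [W.IsGloballyMinimal] (N : ℕ) [NeZero N] (K : Type) [Field K] [NumberField K] (Dt : Literature.NumberTheory.EllipticCurves.ModularForms.ModularParametrizationData W N), Summit.BirchSwinnertonDyer.Rank1Residual.Additive.ClassO6 W 3 → Literature.NumberTheory.EllipticCurves.Rank1Residual.Red W 3 → (∃ Φ : AddSubgroup (WeierstrassCurve.geomTorsion W ((3 : ℕ) : ℤ)), Literature.NumberTheory.EllipticCurves.Rank1Residual.IsRationalLine W 3 Φ ∧ ∀ (v : IsDedekindDomain.HeightOneSpectrum (NumberField.RingOfIntegers ℚ)), ((3 : ℕ) : NumberField.RingOfIntegers ℚ) ∈ v.asIdeal → ∀ 𝔓 ∈ v.primesAbove, ¬ (∀ g ∈ 𝔓.decompositionSubgroup (Field.absoluteGaloisGroup ℚ), ∀ P ∈ Φ, g • P = P) ∧ ¬ (∀ g ∈ 𝔓.decompositionSubgroup (Field.absoluteGaloisGroup ℚ),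 ∀ P : WeierstrassCurve.geomTorsion W ((3 : ℕ) : ℤ), g • P - P ∈ Φ)) → W.analyticRank = 1 → W.conductorNorm ℤ = N → Literature.NumberTheory.EllipticCurves.IsImaginaryQuadratic K → Literature.NumberTheory.EllipticCurves.SatisfiesHeegnerHypothesis N K → ∀ (κ : Literature.NumberTheory.EllipticCurves.ZpExtension K 3), κ.IsAnticyclotomic → ∀ (γ : Field.absoluteGaloisGroup K) [Fact (κ.IsTopGenerator γ)] (𝔭 : IsDedekindDomain.HeightOneSpectrum (NumberField.RingOfIntegers K)), ((3 : ℕ) : NumberField.RingOfIntegers K) ∈ 𝔭.asIdeal → 𝔭.asIdeal.ramificationIdx (NumberField.RingOfIntegers ℚ) = 1 → 𝔭.asIdeal.inertiaDeg (NumberField.RingOfIntegers ℚ) = 1 → ∀ (𝔭' : IsDedekindDomain.HeightOneSpectrum (NumberField.RingOfIntegers K)), ((3 : ℕ) : NumberField.RingOfIntegers K) ∈ 𝔭'.asIdeal → 𝔭' ≠ 𝔭 → ∀ (ι' : PadicAlgCl 3 ≃+* ℂ), Summit.BirchSwinnertonDyer.BirchSwinnertonDyer.Theorems.SchneiderFree.BranchInducesPrime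 3 ι' 𝔭 → ∀ (ΩK : ℂ) (Ωp : ℂ_[3]) (L : Literature.NumberTheory.EllipticCurves.UnrSeries 3), ΩK ≠ 0 → Ωp ≠ 0 → Literature.NumberTheory.EllipticCurves.IsBDPLFunction ι' 𝔭 κ γ Dt.f ΩK Ωp L → Ideal.span {L} ≤ (Summit.BirchSwinnertonDyer.Rank1Residual.X11b.AcSelmer.XAc.charIdeal (W.baseChange K) 3 κ 𝔭' ∅ γ).map (PowerSeries.map (Summit.BirchSwinnertonDyer.Rank1Residual.X11b.Halves.toUnr 3))

-- parent: CumulativeHeegnerInclusionAtThree · child (gen 1)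
/--     item stmt-BirchSwinnertonDyer-26896 · crux · rank 201 · open
    parent: CumulativeHeegnerInclusionAtThree · by planner
    why it might fail: ≥3 unprinted theorems at an ADDITIVE prime: a₃=0 forces Tr y_{3^(k+1)}=0 (no bounded norm-compatible Heegner family); no Coleman map/reciprocity over the wildly ramified local tower at 3²∣N (an order-1 tempered class is not pinned by finite-order values); Howard (H.4)/(H.5) unprinted for additive T
    sources: CastellaGrossiLeeSkinner2022, CastellaGrossiSkinner2025, Castella2018, Howard2004, BurungaleBuyukbodukLei2024, doi:10.4064/aa-85-3-235-248
[crux; = stub A `stub_temperedInclusion` of K1 line birth v3 VERBATIM, promoted on the K1 lead's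
`promote-stub` (chl-k1-p1 g0 05:37Z)] The TEMPERED inclusion on the Leopoldt cell (wild additive 3 —
so a₃ = 0 —, E[3] reducible with NON-anomalous rational line, r_an = 1, K Heegner for N = N_E with 3
split, any anticyclotomic ℤ₃-tower κ, generator γ, primes 𝔭 ≠ 𝔭′ over 3, branch ι′ inducing 𝔭, BDP
measure L at 𝔭): span(3^μ · L) ⊆ Ch_Λ(X_{∅,0}(𝔭′)) · R₀⟦T⟧ for SOME μ — i.e. K1 ⊗ Λ[1/3], the
rational anticyclotomic BDP divisibility at an ADDITIVE prime (cumulative class κ♮ = (3^{-m} Σ_{k≤m}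
y_{3^k})_m, a Coleman/Leopoldt reciprocity Col♮(loc_𝔭 κ♮) ≐ ℒ_𝔭 at 3² ∣ N, Howard's Kolyvagin-system
bound with residually reducible T and E(K)[3] = 0). K1 = A ∧ (μ-half ⟸ B1, p606940) ∧ saturation
(p595383); composition p611195. The only research content of K1. -/
@[route_item "route-BirchSwinnertonDyer-CumulativeHeegnerLeopoldt", crux]
def TemperedHeegnerInclusionAtThree : Prop :=
  ∀ (W : WeierstrassCurve ℚ) [W.IsElliptic] [W.IsGloballyMinimal] (N : ℕ) [NeZero N] (K : Type) [Field K] [NumberField K] (Dt : Literature.NumberTheory.EllipticCurves.ModularForms.ModularParametrizationData W N), Summit.BirchSwinnertonDyer.Rank1Residual.Additive.ClassO6 W 3 → Literature.NumberTheory.EllipticCurves.Rank1Residual.Red W 3 → (∃ Φ : AddSubgroup (WeierstrassCurve.geomTorsion W ((3 : ℕ) : ℤ)), Literature.NumberTheory.EllipticCurves.Rank1Residual.IsRationalLine W 3 Φ ∧ ∀ (v : IsDedekindDomain.HeightOneSpectrum (NumberField.RingOfIntegers ℚ)), ((3 : ℕ) : NumberField.RingOfIntegers ℚ) ∈ v.asIdeal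 → ∀ 𝔓 ∈ v.primesAbove, ¬ (∀ g ∈ 𝔓.decompositionSubgroup (Field.absoluteGaloisGroup ℚ), ∀ P ∈ Φ, g • P = P) ∧ ¬ (∀ g ∈ 𝔓.decompositionSubgroup (Field.absoluteGaloisGroup ℚ), ∀ P : WeierstrassCurve.geomTorsion W ((3 : ℕ) : ℤ), g • P - P ∈ Φ)) → W.analyticRank = 1 → W.conductorNorm ℤ = N → Literature.NumberTheory.EllipticCurves.IsImaginaryQuadratic K → Literature.NumberTheory.EllipticCurves.SatisfiesHeegnerHypothesis N K → ∀ (κ : Literature.NumberTheory.EllipticCurves.ZpExtension K 3), κ.IsAnticyclotomic → ∀ (γ : Field.absoluteGaloisGroup K) [Fact (κ.IsTopGenerator γ)] (𝔭 : IsDedekindDomain.HeightOneSpectrum (NumberField.RingOfIntegers K)), ((3 : ℕ) : NumberField.RingOfIntegers K) ∈ 𝔭.asIdeal → 𝔭.asIdeal.ramificationIdx (NumberField.RingOfIntegers ℚ) = 1 → 𝔭.asIdeal.inertiaDeg (NumberField.RingOfIntegers ℚ) = 1 → ∀ (𝔭' : IsDedekindDomain.HeightOneSpectrum (NumberField.RingOfIntegers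 K)), ((3 : ℕ) : NumberField.RingOfIntegers K) ∈ 𝔭'.asIdeal → 𝔭' ≠ 𝔭 → ∀ (ι' : PadicAlgCl 3 ≃+* ℂ), Summit.BirchSwinnertonDyer.BirchSwinnertonDyer.Theorems.SchneiderFree.BranchInducesPrime 3 ι' 𝔭 → ∀ (ΩK : ℂ) (Ωp : ℂ_[3]) (L : Literature.NumberTheory.EllipticCurves.UnrSeries 3), ΩK ≠ 0 → Ωp ≠ 0 → Literature.NumberTheory.EllipticCurves.IsBDPLFunction ι' 𝔭 κ γ Dt.f ΩK Ωp L → ∃ μ : ℕ, Ideal.span {(3 : Literature.NumberTheory.EllipticCurves.UnrSeries 3) ^ μ * L} ≤ (Summit.BirchSwinnertonDyer.Rank1Residual.X11b.AcSelmer.XAc.charIdeal (W.baseChange K) 3 κ 𝔭' ∅ γ).map (PowerSeries.map (Summit.BirchSwinnertonDyer.Rank1Residual.X11b.Halves.toUnr 3))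

-- parent: CumulativeHeegnerInclusionAtThree · child (gen 1)
/--     item stmt-BirchSwinnertonDyer-26897 · support · rank 202 · open
    parent: CumulativeHeegnerInclusionAtThree · by planner
    sources: CastellaGrossiLeeSkinner2022, Rubin1991
[support, PUB by name — print input, permanently open like PublishedInputGZK]
Castella–Grossi–Lee–Skinner, Invent. Math. 227 (2022) §1.2 Prop. 14 (`propchar`), finiteness clause,
K_∞-formulation: for p odd split in the imaginary quadratic K, a character module M of order p
unramified outside a finite split-prime set S ∌ p and non-anomalous at 𝔭 (θ|G_𝔭 ∉ {1, ω}), the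
residual S-imprimitive Greenberg Selmer group H¹_{F_Gr}^S(K_∞, M) (strict at 𝔭) is FINITE (Rubin
1991 MC + Hida μ = 0). Typed by the K1 lead as the named fact
`CastellaGrossiLeeSkinner2022.prop14_residualCharacterSelmer_finite` (p610776, statement lane); the
ONE printed input of stub B1's port (K1 lineage files
…StubResidualSelmerFinite{Named,Devissage*,PrintHypotheses}, …LineBaseChange, …TowerFixed). -/
@[route_item "route-BirchSwinnertonDyer-CumulativeHeegnerLeopoldt", crux]
def ResidualSelmerPrintedInputAtThree : Prop :=
  Literature.NumberTheory.EllipticCurves.CastellaGrossiLeeSkinner2022.prop14_residualCharacterSelmer_finite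

-- parent: CumulativeHeegnerInclusionAtThree · child (gen 1)
/--     item stmt-BirchSwinnertonDyer-26898 · support · rank 203 · closed · proved by Summit.BirchSwinnertonDyer.BirchSwinnertonDyer.Theorems.cumulativeHeegnerLeopoldt_residualSelmerFiniteAtThreeOfPrint_proof (prover)
    parent: CumulativeHeegnerInclusionAtThree · by planner
    sources: CastellaGrossiLeeSkinner2022
[support; conclusion = stub B1 `stub_residualSelmerFinite` of K1 line birth v3 VERBATIM, hypothesis
= the sibling print item BY NAME] From CGLS22 Prop. 14: on the Leopoldt cell (wild additive 3, E[3]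
reducible with non-anomalous rational line, K imaginary quadratic Heegner for N = N_E, κ
anticyclotomic, 𝔭′ ∣ 3) the 3-torsion of Castella's anticyclotomic Selmer group Sel_{𝔭′}(K_∞,
E[3^∞]) (strict at 𝔭′, relaxed at the other prime, Σ = ∅) is finite. Port = dévissage Φ_K ↪ E[3] ↠
E[3]/Φ_K (p607710, p609208, p609817, p609974, p610469, p610942, p611467), non-anomalous transport
(p611257, p611775), side hypotheses for Σ_bad (p612239); the K1 lead's
`stub_residualSelmerFinite_of_print` closes it. With the print item it gives B1, hence K1's μ-half
(p606940) and K2's algebraic half (p609299) and K2 ↔ K2′ (p610835). -/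
@[route_item "route-BirchSwinnertonDyer-CumulativeHeegnerLeopoldt"]
def ResidualSelmerFiniteAtThreeOfPrint : Prop :=
  ResidualSelmerPrintedInputAtThree → ∀ (W : WeierstrassCurve ℚ) [W.IsElliptic] [W.IsGloballyMinimal] (N : ℕ) [NeZero N] (K : Type) [Field K] [NumberField K], Summit.BirchSwinnertonDyer.Rank1Residual.Additive.ClassO6 W 3 → Literature.NumberTheory.EllipticCurves.Rank1Residual.Red W 3 → (∃ Φ : AddSubgroup (WeierstrassCurve.geomTorsion W ((3 : ℕ) : ℤ)), Literature.NumberTheory.EllipticCurves.Rank1Residual.IsRationalLine W 3 Φ ∧ ∀ (v : IsDedekindDomain.HeightOneSpectrum (NumberField.RingOfIntegers ℚ)), ((3 : ℕ) : NumberField.RingOfIntegers ℚ) ∈ v.asIdeal → ∀ 𝔓 ∈ v.primesAbove, ¬ (∀ g ∈ 𝔓.decompositionSubgroup (Field.absoluteGaloisGroup ℚ), ∀ P ∈ Φ, g • P = P) ∧ ¬ (∀ g ∈ 𝔓.decompositionSubgroup (Field.absoluteGaloisGroup ℚ), ∀ P : WeierstrassCurve.geomTorsion W ((3 : ℕ)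 : ℤ), g • P - P ∈ Φ)) → W.conductorNorm ℤ = N → Literature.NumberTheory.EllipticCurves.IsImaginaryQuadratic K → Literature.NumberTheory.EllipticCurves.SatisfiesHeegnerHypothesis N K → ∀ (κ : Literature.NumberTheory.EllipticCurves.ZpExtension K 3), κ.IsAnticyclotomic → ∀ (𝔭' : IsDedekindDomain.HeightOneSpectrum (NumberField.RingOfIntegers K)), ((3 : ℕ) : NumberField.RingOfIntegers K) ∈ 𝔭'.asIdeal → Set.Finite {s : Summit.BirchSwinnertonDyer.Rank1Residual.X11b.AcSelmer.selmerAc (W.baseChange K) 3 κ 𝔭' ∅ | (3 : ℕ) • s = 0}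

-- `ResidualSelmerFiniteAtThreeOfPrint` holds: proved by `Summit.BirchSwinnertonDyer.BirchSwinnertonDyer.Theorems.cumulativeHeegnerLeopoldt_residualSelmerFiniteAtThreeOfPrint_proof` (its module imports this route file, so no `_holds` link can be stated here).

-- parent: CumulativeHeegnerInclusionAtThree · glue (gen 1)
/--     item stmt-BirchSwinnertonDyer-26899 · support · rank 204 · closed · proved by Summit.BirchSwinnertonDyer.BirchSwinnertonDyer.Theorems.cumulativeHeegnerLeopoldt_cumulativeHeegnerInclusionAtThreeGlue_proof (prover)
    parent: CumulativeHeegnerInclusionAtThree · GLUE: children ⟹ parent · by planner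
TemperedHeegnerInclusionAtThree → ResidualSelmerPrintedInputAtThree →
ResidualSelmerFiniteAtThreeOfPrint → CumulativeHeegnerInclusionAtThree; closable NOW by the
one-liner fun hA hP hB =>
Summit.BirchSwinnertonDyer.BirchSwinnertonDyer.Theorems.CumulativeHeegnerLeopoldtResidualContent.cumulativeHeegnerInclusionAtThree_of_temperedInclusion_of_residualSelmerFinite
hA (hB hP) (p611195; kernel-checked as glueShape_closable in the pen's scratch) -/
@[route_item "route-BirchSwinnertonDyer-CumulativeHeegnerLeopoldt"]
def CumulativeHeegnerInclusionAtThreeGlue : Prop :=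
  TemperedHeegnerInclusionAtThree → ResidualSelmerPrintedInputAtThree → ResidualSelmerFiniteAtThreeOfPrint → CumulativeHeegnerInclusionAtThree

-- `CumulativeHeegnerInclusionAtThreeGlue` holds: proved by `Summit.BirchSwinnertonDyer.BirchSwinnertonDyer.Theorems.cumulativeHeegnerLeopoldt_cumulativeHeegnerInclusionAtThreeGlue_proof` (its module imports this route file, so no `_holds` link can be stated here).

/-- item stmt-BirchSwinnertonDyer-23970 · crux · rank 3 · open · by planner
why it might fail: μ(ℒ_𝔭^BDP) = 0 at an additive Eisenstein p = 3 is open (Hsieh's μ-theorem needs p ∤ N or (sur)); the Λ-adic BDP–Katz Eisenstein congruence at 27 ∣ N has no printed proof (stub AN); Tamagawa 3-torsion at additive ℓ ≠ 3 of K enters λ(g). Odd d_K removes no difficulty, only scope.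
sources: CastellaGrossiSkinner2025, Hsieh2014, arXiv:2405.00270, Rubin1991, arXiv:1801.01619
[crux, ODD-DISCRIMINANT CUT of K2 24199 — rev 7 (content of record refreshed rev 9), on the K2 lead
chl-p1 g9's restate datum 00:58:20Z] Same frame as K2: char_Λ X_{∅,0} (at 𝔭′, mapped to Λ^ur) is
principal, generated by some g, and g and the BDP measure L have μ = 0 and the SAME λ-invariant
(index of the first unit coefficient) — the Eisenstein comparison through the two characters φ, ψ =
ωφ⁻¹ of E[3]^ss (Rubin two-variable IMC for K at 3 on the algebraic side; BDP–Katz congruence +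
Hida/Hsieh μ = 0 on the analytic side), on the non-anomalous cell — NOW WITH the binder `Odd
(NumberField.discr K)` inserted after `SatisfiesHeegnerHypothesis N K`: every typed print input of
the line (Hida/Hsieh μ = 0, Katz `thm212`, BDP13 Thm 5.5) carries it, and the deciding chain
consumes K2 only at the kernel's own Friedberg–Hoffstein field with auxiliary modulus 2, where d_K
is odd (Theorems/…LeopoldtKernelAtThreeOfPrint.lean l.97–101 derives hodd before the single K2
application l.169) — so this is ALL `closes` uses; the ∀-d_K form 24199 is kept as a banked aside
(24199 → this statement trivially: pen scratch `eisensteinCharacterInvariantsAtThreeOdd_of_K2`, rc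
0) and every landed consumer of 241 -/
@[route_item "route-BirchSwinnertonDyer-CumulativeHeegnerLeopoldt", crux]
def EisensteinCharacterInvariantsAtThreeOdd : Prop :=
  ∀ (W : WeierstrassCurve ℚ) [W.IsElliptic] [W.IsGloballyMinimal] (N : ℕ) [NeZero N] (K : Type) [Field K] [NumberField K] (Dt : Literature.NumberTheory.EllipticCurves.ModularForms.ModularParametrizationData W N), Summit.BirchSwinnertonDyer.Rank1Residual.Additive.ClassO6 W 3 → Literature.NumberTheory.EllipticCurves.Rank1Residual.Red W 3 → (∃ Φ : AddSubgroup (WeierstrassCurve.geomTorsion W ((3 : ℕ) : ℤ)), Literature.NumberTheory.EllipticCurves.Rank1Residual.IsRationalLine W 3 Φ ∧ ∀ (v : IsDedekindDomain.HeightOneSpectrum (NumberField.RingOfIntegers ℚ)), ((3 : ℕ) : NumberField.RingOfIntegers ℚ) ∈ v.asIdeal → ∀ 𝔓 ∈ v.primesAbove, ¬ (∀ g ∈ 𝔓.decompositionSubgroup (Field.absoluteGaloisGroup ℚ), ∀ P ∈ Φ, g • P = P) ∧ ¬ (∀ g ∈ 𝔓.decompositionSubgroup (Field.absoluteGaloisGroup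 ℚ), ∀ P : WeierstrassCurve.geomTorsion W ((3 : ℕ) : ℤ), g • P - P ∈ Φ)) → W.analyticRank = 1 → W.conductorNorm ℤ = N → Literature.NumberTheory.EllipticCurves.IsImaginaryQuadratic K → Literature.NumberTheory.EllipticCurves.SatisfiesHeegnerHypothesis N K → Odd (NumberField.discr K) → ∀ (κ : Literature.NumberTheory.EllipticCurves.ZpExtension K 3), κ.IsAnticyclotomic → ∀ (γ : Field.absoluteGaloisGroup K) [Fact (κ.IsTopGenerator γ)] (𝔭 : IsDedekindDomain.HeightOneSpectrum (NumberField.RingOfIntegers K)), ((3 : ℕ) : NumberField.RingOfIntegers K) ∈ 𝔭.asIdeal → 𝔭.asIdeal.ramificationIdx (NumberField.RingOfIntegers ℚ) = 1 → 𝔭.asIdeal.inertiaDeg (NumberField.RingOfIntegers ℚ) = 1 → ∀ (𝔭' : IsDedekindDomain.HeightOneSpectrum (NumberField.RingOfIntegers K)), ((3 : ℕ) : NumberField.RingOfIntegers K) ∈ 𝔭'.asIdeal → 𝔭' ≠ 𝔭 → ∀ (ι' : PadicAlgCl 3 ≃+* ℂ), Summit.BirchSwinnertonDyer.BirchSwinnertonDyer.Theorems.SchneiderFree.BranchInducesPrime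 3 ι' 𝔭 → ∀ (ΩK : ℂ) (Ωp : ℂ_[3]) (L : Literature.NumberTheory.EllipticCurves.UnrSeries 3), ΩK ≠ 0 → Ωp ≠ 0 → Literature.NumberTheory.EllipticCurves.IsBDPLFunction ι' 𝔭 κ γ Dt.f ΩK Ωp L → ∃ (g : Literature.NumberTheory.EllipticCurves.UnrSeries 3) (n : ℕ), (Summit.BirchSwinnertonDyer.Rank1Residual.X11b.AcSelmer.XAc.charIdeal (W.baseChange K) 3 κ 𝔭' ∅ γ).map (PowerSeries.map (Summit.BirchSwinnertonDyer.Rank1Residual.X11b.Halves.toUnr 3)) = Ideal.span {g} ∧ (∀ i < n, ‖((PowerSeries.coeff i g : Literature.NumberTheory.EllipticCurves.unrIntegers 3) : ℂ_[3])‖ < 1) ∧ ‖((PowerSeries.coeff n g : Literature.NumberTheory.EllipticCurves.unrIntegers 3) : ℂ_[3])‖ = 1 ∧ (∀ i < n, ‖((PowerSeries.coeff i L : Literature.NumberTheory.EllipticCurves.unrIntegers 3) : ℂ_[3])‖ < 1) ∧ ‖((PowerSeries.coeff n L : Literature.NumberTheory.EllipticCurves.unrIntegers 3) : ℂ_[3])‖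 = 1

/-- item stmt-BirchSwinnertonDyer-24200 · crux · rank 5 · closed · proved by Summit.BirchSwinnertonDyer.BirchSwinnertonDyer.Theorems.RedSplitControlAtThreeOfFacts.redSplitControlAtThree_proof (prover) · by planner
why it might fail: with E[3] reducible the control error at T = 0 picks up E(K)[3] and the 3-part of Tamagawa numbers at additive ℓ ∣ N inert-free but possibly ramified in K(E[3]); UTD's proved control glue (p526934) used surjectivity for local finiteness at 𝔭.
sources: Greenberg1999, JetchevSkinnerWan2017, CastellaGrossiSkinner2025
[crux] Anticyclotomic control at the trivial character on the Leopoldt cell: for E, K, the Heegner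
point P = y_K of infinite order (r_an(E/K) = 1 with the twist value non-zero) and Kolyvagin's
theorem, the on-tree control statement `SchneiderFree.AdditiveControlOnTreeAt 3 κ 𝔭 γ emb P` (the
UTD control item with the onto-image hypothesis replaced by reducible + non-anomalous line) —
#Ш(E/K)[3^∞]·(index data) is read off X_{∅,0} at T = 0, the local condition at 𝔭 ∣ 3 being Ê(𝔪) = 𝔪
(𝔾_a, finite cokernel by Lettl) and E(K_𝔭)[3] = 0 on the cell. [deps: WildSplitFrameAtThree]
[difficulty: L] -/
@[route_item "route-BirchSwinnertonDyer-CumulativeHeegnerLeopoldt", crux]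
def RedSplitControlAtThree : Prop :=
  ∀ (W : WeierstrassCurve ℚ) [W.IsElliptic] [W.IsGloballyMinimal] (N : ℕ) [NeZero N] (K : Type) [Field K] [NumberField K] (Dt : Literature.NumberTheory.EllipticCurves.ModularForms.ModularParametrizationData W N) (H : Literature.NumberTheory.EllipticCurves.HeegnerDatum N (NumberField.discr K)) (ι : K →+* ℂ) (P : (W.baseChange K).toAffine.Point), Summit.BirchSwinnertonDyer.Rank1Residual.Additive.ClassO6 W 3 → Literature.NumberTheory.EllipticCurves.Rank1Residual.Red W 3 → (∃ Φ : AddSubgroup (WeierstrassCurve.geomTorsion W ((3 : ℕ) : ℤ)), Literature.NumberTheory.EllipticCurves.Rank1Residual.IsRationalLine W 3 Φ ∧ ∀ (v : IsDedekindDomain.HeightOneSpectrum (NumberField.RingOfIntegers ℚ)), ((3 : ℕ) : NumberField.RingOfIntegers ℚ) ∈ v.asIdeal → ∀ 𝔓 ∈ v.primesAbove, ¬ (∀ g ∈ 𝔓.decompositionSubgroup (Field.absoluteGaloisGroup ℚ), ∀ P ∈ Φ, g • P = P) ∧ ¬ (∀ g ∈ 𝔓.decompositionSubgroup (Field.absoluteGaloisGroup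 ℚ), ∀ P : WeierstrassCurve.geomTorsion W ((3 : ℕ) : ℤ), g • P - P ∈ Φ)) → W.analyticRank = 1 → W.conductorNorm ℤ = N → Literature.NumberTheory.EllipticCurves.IsImaginaryQuadratic K → Literature.NumberTheory.EllipticCurves.SatisfiesHeegnerHypothesis N K → (W.quadraticTwist (NumberField.discr K : ℚ)).entireLFunction 1 ≠ 0 → (WeierstrassCurve.Affine.Point.map ι.toRatAlgHom) P = Literature.NumberTheory.EllipticCurves.ModularForms.heegnerPointComplex Dt H → ¬ IsOfFinAddOrder P → Literature.NumberTheory.EllipticCurves.kolyvagin N W K → ∀ (κ : Literature.NumberTheory.EllipticCurves.ZpExtension K 3), κ.IsAnticyclotomic → ∀ (γ : Field.absoluteGaloisGroup K) [Fact (κ.IsTopGenerator γ)] (𝔭 : IsDedekindDomain.HeightOneSpectrum (NumberField.RingOfIntegers K)) (h𝔭 : ((3 : ℕ) : NumberField.RingOfIntegers K) ∈ 𝔭.asIdeal) (he : 𝔭.asIdeal.ramificationIdx (NumberField.RingOfIntegers ℚ) = 1) (hf : 𝔭.asIdeal.inertiaDeg (NumberField.RingOfIntegers ℚ) = 1), Summit.BirchSwinnertonDyer.BirchSwinnertonDyer.Theorems.SchneiderFree.AdditiveControlOnTreeAt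 3 κ 𝔭 γ (Summit.BirchSwinnertonDyer.Rank1Residual.X11b.embAt K 3 𝔭 h𝔭 he hf) P

-- `RedSplitControlAtThree` holds: proved by `Summit.BirchSwinnertonDyer.BirchSwinnertonDyer.Theorems.RedSplitControlAtThreeOfFacts.redSplitControlAtThree_proof` (its module imports this route file, so no `_holds` link can be stated here).

/-- item stmt-BirchSwinnertonDyer-20387 · crux · RESIDUAL (gen 0; summit-strength until shown otherwise, D-0170) · rank 6 · open · by planner
why it might fail: it is itself 11 250 classes of open BSD₃ at rank zero with a₃ = 0 (Kato's Euler system divisibility at additive 3 is known, the equality is not: no finite-slope family through f_E).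
sources: Kato2004, FouquetWan2021
[crux] RESIDUAL BY NAME — the rank-zero wild rows of W-ALL: for every non-CM E/ℚ wild at 3 (ClassO6)
with r_an = 0, BSD₃(E) (leaf `WAllExclAddWildRankZero`, K9's `WildRankZero` / W2's engines); the
kernel consumes it for the quadratic twist E^(d_K), which is again wild at 3 (3 ∤ d_K) with r_an =
0. [difficulty: XL] -/
@[route_item "route-BirchSwinnertonDyer-CumulativeHeegnerLeopoldt", crux (bottleneck := idea) (source := "ledger wanted_by.residual on stmt-BirchSwinnertonDyer-20387, 2026-09-01")]
def WildRankZeroTwistAtThree : Prop :=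
  Summit.BirchSwinnertonDyer.WAllExclAddWildRankZero

/-- item stmt-BirchSwinnertonDyer-24201 · crux · rank 7 · open · by planner
why it might fail: its reducible half contains the 1 546+ classes with a rational 3-torsion point and a₃ = 0, where even the Λ[1/p] Howard bound (CGS 6.5.2 needs E(K)[p] = 0) is unavailable and AnomalousHeegnerLogWall applies head-on; its irreducible half is three open routes deep.
sources: CastellaGrossiSkinner2025, GreenbergVatsal2000, KrizLi2019
[crux] RESIDUAL (off-cell complement on the wild r1 leaf, 10 907 classes): BSD₃ for the wild-3, r_an
= 1, non-CM curves NOT on the Leopoldt cell — i.e. E[3] irreducible (4 197 classes: exactly the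
leaves `WAllExclAddWildRankOneSurj` of UTD/SOED/CU and `WAllExclAddWildRankOneIrrNotSurj` of the UTD
twin, owned there) or E[3] reducible with ANOMALOUS rational line (6 710 classes, the natural target
of a future Greenberg–Vatsal-type line; NB Kriz–Li 2018 Thm 1.12 / 2019 Thm 7.1 assume hypothesis
(1) ψ(3) ≠ 1 ∧ (ψ⁻¹ω)(3) ≠ 1 = NON-anomalous, so they bear on the Leopoldt cell itself — K1's T = 0
/ unit-log door, chl-k1-p1-w2 g7 LIT-SWEEP-ADDITIVE-w2g7 §5, p645092 — and NOT on this complement) —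
outside this thesis, recorded so the leaf is decided. [difficulty: open-problem] -/
@[route_item "route-BirchSwinnertonDyer-CumulativeHeegnerLeopoldt", crux (bottleneck := idea) (source := "ledger wanted_by.residual on stmt-BirchSwinnertonDyer-24201, 2026-09-01")]
def WildRankOneOffLeopoldtCellAtThree : Prop :=
  ∀ (W : WeierstrassCurve ℚ) [W.IsElliptic] [W.IsGloballyMinimal], ¬ W.HasCM → Summit.BirchSwinnertonDyer.Rank1Residual.Additive.ClassO6 W 3 → W.analyticRank = 1 → ¬ (Literature.NumberTheory.EllipticCurves.Rank1Residual.Red W 3 ∧ (∃ Φ : AddSubgroup (WeierstrassCurve.geomTorsion W ((3 : ℕ) : ℤ)), Literature.NumberTheory.EllipticCurves.Rank1Residual.IsRationalLine W 3 Φ ∧ ∀ (v : IsDedekindDomain.HeightOneSpectrum (NumberField.RingOfIntegers ℚ)), ((3 : ℕ) : NumberField.RingOfIntegers ℚ) ∈ v.asIdeal → ∀ 𝔓 ∈ v.primesAbove, ¬ (∀ g ∈ 𝔓.decompositionSubgroup (Field.absoluteGaloisGroup ℚ), ∀ P ∈ Φ, g • P = P) ∧ ¬ (∀ g ∈ 𝔓.decompositionSubgroup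 (Field.absoluteGaloisGroup ℚ), ∀ P : WeierstrassCurve.geomTorsion W ((3 : ℕ) : ℤ), g • P - P ∈ Φ))) → Literature.NumberTheory.EllipticCurves.BSDp W 3

/-- item stmt-BirchSwinnertonDyer-24040 · crux · rank 301 · open · by planner
why it might fail: F-CHL-A5-2 (T2 add-5): the typed SYMMETRIC Euler-factor sum Σ_{w∣N}(λ𝒫_w(θsub)+λ𝒫_w(θquot)) vs CGLS §2.2's φ/ψ-PARTITIONED factor 𝓔_{φ,ψ}; at additive 27 ∣ N extra factors at 3 or a non-unit period ratio may shift λ, or μ(L) > 0 (no μ-theorem at additive p ∣ N).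
sources: CastellaGrossiLeeSkinner2022, KellerYin2024, arXiv:1512.05032
[support → crux after a one-shot vet; PROMOTE-STUB of the K2 LEAD chl-p1 g9's seat outcome 02:03:19Z
— rev 9] `stub_anCongruenceCore` of line birth v5 a938f29ff5eb8691 (skeleton check 02:02:24Z on
24199; to be re-registered on 23970 as v6 = v5 minus stub EVEN) VERBATIM, with the three short names
the birth file resolves through `open … Literature.NumberTheory.GaloisRepresentations` qualified for
the route-file context (FramedGaloisRep, HeckeCharacter ↦
Literature.NumberTheory.GaloisRepresentations._; padicCoeffIntegers ↦
Literature.NumberTheory.EllipticCurves._); pen scratch: item text = registered stub type by `rfl`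
(scratch-promote-b 094923a912815835, rc 0) and elaborates on the route-file imports +
`Literature.NumberTheory.EllipticCurves.KellerYin2024.AnomalousLambdaInvariants` (scratch-promote-a
65e5aec52d30beb7, rc 0; import added at this rev). CONTENT: the analytic CORE of K2-odd — the
additive Λ-adic Eisenstein congruence ℒ_𝔭 ≡ 𝓔·L_φ·L_ψ for the born-depleted BDP measure L of (E, K,
𝔭) on Ig(N/3^a) at 27 ∣ N, on the Leopoldt cell (Red, a rational line Φ ⊂ E[3] with E[3]_𝔓 neither
fixed nor Φ-cofixed), r_an = 1, Heegner hypothesis, ODD d_K, 𝔭 | 3 of K split-type (e = f = 1) w -/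
@[route_item "route-BirchSwinnertonDyer-CumulativeHeegnerLeopoldt"]
def EisensteinCongruenceCoreAtThree : Prop :=
  ∀ (W : WeierstrassCurve ℚ) [W.IsElliptic] [W.IsGloballyMinimal] (N : ℕ) [NeZero N] (K : Type) [Field K] [NumberField K] (Dt : Literature.NumberTheory.EllipticCurves.ModularForms.ModularParametrizationData W N), Summit.BirchSwinnertonDyer.Rank1Residual.Additive.ClassO6 W 3 → Literature.NumberTheory.EllipticCurves.Rank1Residual.Red W 3 → (∃ Φ : AddSubgroup (WeierstrassCurve.geomTorsion W ((3 : ℕ) : ℤ)), Literature.NumberTheory.EllipticCurves.Rank1Residual.IsRationalLine W 3 Φ ∧ ∀ (v : IsDedekindDomain.HeightOneSpectrum (NumberField.RingOfIntegers ℚ)), ((3 : ℕ) : NumberField.RingOfIntegers ℚ) ∈ v.asIdeal → ∀ 𝔓 ∈ v.primesAbove, ¬ (∀ g ∈ 𝔓.decompositionSubgroup (Field.absoluteGaloisGroup ℚ), ∀ P ∈ Φ, g • P = P) ∧ ¬ (∀ g ∈ 𝔓.decompositionSubgroup (Field.absoluteGaloisGroup ℚ), ∀ P : WeierstrassCurve.geomTorsion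 W ((3 : ℕ) : ℤ), g • P - P ∈ Φ)) → W.analyticRank = 1 → W.conductorNorm ℤ = N → Literature.NumberTheory.EllipticCurves.IsImaginaryQuadratic K → Literature.NumberTheory.EllipticCurves.SatisfiesHeegnerHypothesis N K → Odd (NumberField.discr K) → ∀ (κ : Literature.NumberTheory.EllipticCurves.ZpExtension K 3), κ.IsAnticyclotomic → ∀ (γ : Field.absoluteGaloisGroup K) [Fact (κ.IsTopGenerator γ)] (𝔭 : IsDedekindDomain.HeightOneSpectrum (NumberField.RingOfIntegers K)), ((3 : ℕ) : NumberField.RingOfIntegers K) ∈ 𝔭.asIdeal → 𝔭.asIdeal.ramificationIdx (NumberField.RingOfIntegers ℚ) = 1 → 𝔭.asIdeal.inertiaDeg (NumberField.RingOfIntegers ℚ) = 1 → ∀ (𝔭' : IsDedekindDomain.HeightOneSpectrum (NumberField.RingOfIntegers K)), ((3 : ℕ) : NumberField.RingOfIntegers K) ∈ 𝔭'.asIdeal → 𝔭' ≠ 𝔭 → ∀ (ι' : PadicAlgCl 3 ≃+* ℂ), Summit.BirchSwinnertonDyer.BirchSwinnertonDyer.Theorems.SchneiderFree.BranchInducesPrime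 3 ι' 𝔭 → ∀ (ΩK : ℂ) (Ωp : ℂ_[3]) (L : Literature.NumberTheory.EllipticCurves.UnrSeries 3), ΩK ≠ 0 → Ωp ≠ 0 → Literature.NumberTheory.EllipticCurves.IsBDPLFunction ι' 𝔭 κ γ Dt.f ΩK Ωp L → ∀ (θsub θquot : Literature.NumberTheory.GaloisRepresentations.FramedGaloisRep ℚ (Literature.NumberTheory.EllipticCurves.padicCoeffIntegers (∅ : Set (PadicAlgCl 3))) 1), Literature.NumberTheory.EllipticCurves.KellerYin2024.IsResidualPairOver (W.baseChange K) 3 (θsub.restrictField K) (θquot.restrictField K) → ∀ (θunr : Literature.NumberTheory.GaloisRepresentations.FramedGaloisRep ℚ (Literature.NumberTheory.EllipticCurves.padicCoeffIntegers (∅ : Set (PadicAlgCl 3))) 1), (θunr = θsub ∨ θunr = θquot) → (∀ u : IsDedekindDomain.HeightOneSpectrum (NumberField.RingOfIntegers ℚ), ((3 : ℕ) : NumberField.RingOfIntegers ℚ) ∈ u.asIdeal → θunr.IsUnramifiedAt u) → ∀ (Sf : Finset (IsDedekindDomain.HeightOneSpectrum (NumberField.RingOfIntegers K))), (∀ w :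 IsDedekindDomain.HeightOneSpectrum (NumberField.RingOfIntegers K), w ∈ Sf ↔ ((W.conductorNorm ℤ : ℤ) : NumberField.RingOfIntegers K) ∈ w.asIdeal) → ∀ (θK : Literature.NumberTheory.GaloisRepresentations.HeckeCharacter K), Literature.NumberTheory.EllipticCurves.KellerYin2024.IsHeckeCharOf ι' (θunr.restrictField K) θK → ∀ (Cbar : Finset (IsDedekindDomain.HeightOneSpectrum (NumberField.RingOfIntegers K))), (∀ u ∈ Cbar, ¬ θK.IsUnramifiedAt u) → ∀ (ΩK' : ℂ) (Ωp' : (Literature.NumberTheory.EllipticCurves.unrIntegers 3)ˣ) (Lφ : Literature.NumberTheory.EllipticCurves.UnrSeries 3), ΩK' ≠ 0 → Literature.NumberTheory.EllipticCurves.CastellaGrossiLeeSkinner2022.IsKatzLFunction ι' 𝔭 𝔭' Cbar κ γ θK ΩK' ((Ωp' : Literature.NumberTheory.EllipticCurves.unrIntegers 3) : ℂ_[3]) Lφ → ∀ nφ : ℕ, Literature.NumberTheory.EllipticCurves.KellerYin2024.FirstUnitCoeffAt Lφ nφ → ∃ n : ℕ, Literature.NumberTheory.EllipticCurves.KellerYin2024.FirstUnitCoeffAt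 L n ∧ n + ∑ w ∈ Sf, Literature.NumberTheory.EllipticCurves.KellerYin2024.curveLocalLambda κ (W.baseChange K) w = 2 * nφ + ∑ w ∈ Sf, (Literature.NumberTheory.EllipticCurves.KellerYin2024.charLocalLambda (∅ : Set (PadicAlgCl 3)) κ (θsub.restrictField K) w + Literature.NumberTheory.EllipticCurves.KellerYin2024.charLocalLambda (∅ : Set (PadicAlgCl 3)) κ (θquot.restrictField K) w)

/-- item stmt-BirchSwinnertonDyer-20456 · aside · rank 2 · open · by planner
sources: Hsieh2014
[support] published input, by name: Hsieh, Doc. Math. 19 (2014) Thm A at ANY level (no ¬ p² ∣ N;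
periods (Ω_K, Ω_p) with Ω_p ∈ R₀ˣ) = the tree fact
`Literature.NumberTheory.EllipticCurves.Hsieh2014.thmA_exists_isHsiehLFunction_unrPeriod_anyLevel`
(def : Prop, cite-tagged). Consumed by `closes` as the antecedent of (W♭); gives the ♭-frame's
EXISTENCE via the landed `…KatzWaldspurgerFrameCMInertBadFromPrint.exists_frameInt_of_thmA_anyLevel`
(p508877). Closable only by formalising the fact or by an operator grant; it is the route's declared
print input, not a crux. -/
@[route_item "route-BirchSwinnertonDyer-CumulativeHeegnerLeopoldt"]
def HsiehAnyLevelInput : Prop :=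
  Literature.NumberTheory.EllipticCurves.Hsieh2014.thmA_exists_isHsiehLFunction_unrPeriod_anyLevel

/-- item stmt-BirchSwinnertonDyer-24199 · aside · rank 3 · open · by planner
why it might fail: μ(ℒ_𝔭^BDP) = 0 at an additive Eisenstein p = 3 is open (EisensteinMuConjecture scope; Hsieh's μ-theorem needs p ∤ N or (sur)), and the BDP–Katz congruence at p² ∣ N has no printed proof; the 3-torsion of Tamagawa factors at additive primes ℓ ≠ 3 of K enters λ(g).
sources: CastellaGrossiSkinner2025, Hsieh2014, arXiv:2405.00270, Rubin1991
[crux] Same frame: char_Λ X_{∅,0} (at 𝔭′, mapped to Λ^ur) is principal, generated by some g, and g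
and the BDP measure L have μ = 0 and the SAME λ-invariant (index of the first unit coefficient) —
the Eisenstein comparison: both sides are computed from the two characters φ, ψ = ωφ⁻¹ of E[3]^ss
(Rubin's two-variable main conjecture for K at p = 3 on the algebraic side; the BDP–Katz congruence
ℒ_𝔭² ≡ L_𝔭^Katz(φ)·L_𝔭^Katz(ψ) mod the Eisenstein ideal and Hida/Hsieh μ = 0 on the analytic side),
the non-anomalous cell hypothesis killing the local error terms at 𝔭, 𝔭̄ exactly as φ|G_p ∉ {1, ω}
does in CGLS. [deps: WildSplitFrameAtThree] [difficulty: XL] -/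
@[route_item "route-BirchSwinnertonDyer-CumulativeHeegnerLeopoldt", crux]
def EisensteinCharacterInvariantsAtThree : Prop :=
  ∀ (W : WeierstrassCurve ℚ) [W.IsElliptic] [W.IsGloballyMinimal] (N : ℕ) [NeZero N] (K : Type) [Field K] [NumberField K] (Dt : Literature.NumberTheory.EllipticCurves.ModularForms.ModularParametrizationData W N), Summit.BirchSwinnertonDyer.Rank1Residual.Additive.ClassO6 W 3 → Literature.NumberTheory.EllipticCurves.Rank1Residual.Red W 3 → (∃ Φ : AddSubgroup (WeierstrassCurve.geomTorsion W ((3 : ℕ) : ℤ)), Literature.NumberTheory.EllipticCurves.Rank1Residual.IsRationalLine W 3 Φ ∧ ∀ (v : IsDedekindDomain.HeightOneSpectrum (NumberField.RingOfIntegers ℚ)), ((3 : ℕ) : NumberField.RingOfIntegers ℚ) ∈ v.asIdeal → ∀ 𝔓 ∈ v.primesAbove, ¬ (∀ g ∈ 𝔓.decompositionSubgroup (Field.absoluteGaloisGroup ℚ), ∀ P ∈ Φ, g • P = P) ∧ ¬ (∀ g ∈ 𝔓.decompositionSubgroup (Field.absoluteGaloisGroup ℚ), ∀ P : WeierstrassCurve.geomTorsion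 W ((3 : ℕ) : ℤ), g • P - P ∈ Φ)) → W.analyticRank = 1 → W.conductorNorm ℤ = N → Literature.NumberTheory.EllipticCurves.IsImaginaryQuadratic K → Literature.NumberTheory.EllipticCurves.SatisfiesHeegnerHypothesis N K → ∀ (κ : Literature.NumberTheory.EllipticCurves.ZpExtension K 3), κ.IsAnticyclotomic → ∀ (γ : Field.absoluteGaloisGroup K) [Fact (κ.IsTopGenerator γ)] (𝔭 : IsDedekindDomain.HeightOneSpectrum (NumberField.RingOfIntegers K)), ((3 : ℕ) : NumberField.RingOfIntegers K) ∈ 𝔭.asIdeal → 𝔭.asIdeal.ramificationIdx (NumberField.RingOfIntegers ℚ) = 1 → 𝔭.asIdeal.inertiaDeg (NumberField.RingOfIntegers ℚ) = 1 → ∀ (𝔭' : IsDedekindDomain.HeightOneSpectrum (NumberField.RingOfIntegers K)), ((3 : ℕ) : NumberField.RingOfIntegers K) ∈ 𝔭'.asIdeal → 𝔭' ≠ 𝔭 → ∀ (ι' : PadicAlgCl 3 ≃+* ℂ), Summit.BirchSwinnertonDyer.BirchSwinnertonDyer.Theorems.SchneiderFree.BranchInducesPrime 3 ι' 𝔭 →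 ∀ (ΩK : ℂ) (Ωp : ℂ_[3]) (L : Literature.NumberTheory.EllipticCurves.UnrSeries 3), ΩK ≠ 0 → Ωp ≠ 0 → Literature.NumberTheory.EllipticCurves.IsBDPLFunction ι' 𝔭 κ γ Dt.f ΩK Ωp L → ∃ (g : Literature.NumberTheory.EllipticCurves.UnrSeries 3) (n : ℕ), (Summit.BirchSwinnertonDyer.Rank1Residual.X11b.AcSelmer.XAc.charIdeal (W.baseChange K) 3 κ 𝔭' ∅ γ).map (PowerSeries.map (Summit.BirchSwinnertonDyer.Rank1Residual.X11b.Halves.toUnr 3)) = Ideal.span {g} ∧ (∀ i < n, ‖((PowerSeries.coeff i g : Literature.NumberTheory.EllipticCurves.unrIntegers 3) : ℂ_[3])‖ < 1) ∧ ‖((PowerSeries.coeff n g : Literature.NumberTheory.EllipticCurves.unrIntegers 3) : ℂ_[3])‖ = 1 ∧ (∀ i < n, ‖((PowerSeries.coeff i L : Literature.NumberTheory.EllipticCurves.unrIntegers 3) : ℂ_[3])‖ < 1) ∧ ‖((PowerSeries.coeff n L : Literature.NumberTheory.EllipticCurves.unrIntegers 3) : ℂ_[3])‖ = 1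

/-- item stmt-BirchSwinnertonDyer-24474 · aside · rank 3 · open · by planner
sources: BertoliniDarmonPrasanna2013
[aside, by-name single-fact alias — same rule] Bertolini–Darmon–Prasanna 2013 Thm 5.5 with (5.1.16),
Prop 1.12 (1), Lemma 5.3 (Duke Math. J. 162 p. 60): for f the newform of E (conductor N), K
imaginary quadratic Heegner for N with d_K ODD, a period Ω ≠ 0 and a number field F ⊇ K unramified
above every odd prime split in K such that every σ ∈ Aut(ℂ/F) permutes the normalised central values
L(f/K, χ, 1)/(π^{2n+1} Ω^{4n}) of the everywhere-unramified χ of type (n, −n) equivariantly; typed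
fact `Literature.NumberTheory.EllipticCurves.bertoliniDarmonPrasanna2013_centralValue_reciprocity`
(reviewed; tree consumers ClassRecordThreeOpenValueReciprocityOfBDP,
MordellShaFreeCutThreeAdicExistenceFromPrint). Conjunct of WildSplitPrintedInputsAtThree, antecedent
of WildSplitFrameAtThreeOddOfPrint. Banked context: never staffed. -/
@[route_item "route-BirchSwinnertonDyer-CumulativeHeegnerLeopoldt"]
def BDPCentralValueReciprocityInput : Prop :=
  Literature.NumberTheory.EllipticCurves.bertoliniDarmonPrasanna2013_centralValue_reciprocity

/-- item stmt-BirchSwinnertonDyer-20928 · aside · rank 4 · open · by planner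
why it might fail: at p² ∣ N the BDP/Hsieh interpolation (Hsieh 2014 any level is typed for p ∤ N in the tree's `IsHsiehLFunction`) needs the additive local toric integral of LZZ Thm 1.5.3 to be a p-adic analytic family in the anticyclotomic variable, which is printed only pointwise.
sources: Hsieh2014, LiuZhangZhang2018, arXiv:2410.23241
[crux #4d] For W on the wild class at 3 (ClassO6), K imaginary quadratic Heegner for N (3 = 𝔭𝔭′
split), κ anticyclotomic with generator γ, 𝔭 ∋ 3: some embedding datum ι′ induces 𝔭 and an R₀-valued
frame (Ω_K ≠ 0, Ω_p ≠ 0, L ∈ R₀⟦T⟧) with Castella's interpolation property IsBDPLFunction ι′ 𝔭 κ γ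
Dt.f Ω_K Ω_p L exists (Euler-type factor 1: a₃ = 0, ε₃ = 0) — the born-depleted BDP measure at 27 ∣
N. Nearest print: Castella–Hsieh 2018 Def 3.5/Prop 3.6 (p ∤ N), Castella 2018 Thm 3.1 (N
square-free, p ≥ 5); Hsieh 2014 Thm A any level gives the frame over 𝓞_{ℂ₃}⟦T⟧ only (tree:
UniversalToricDescentWaldspurgerFlat.exists_frameInt_value_manin). The VALUE half of #4 is the tree
theorem wildSplitWaldspurgerAtThree_flat (p540475), consumed inside the glue (p541741). Kit:
pub/bsd-potss/bsd-potss-kmc/g19/split-B (kmc g19). CURRENCY CAVEAT (inherited verbatim from the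
parent 20385, not added by the split): the frame is R₀ = 𝓞^unr-typed and quantified over EVERY
Heegner K; for K with 3 ∣ h_K the BDP element may only live over a ramified extension of R₀ (kmc
why-might-fail) — if this child is refuted on such K, the repair is kmc's kit (A) (♭ re-type of
20186/20214/20385 over 𝓞_{ℂ₃}⟦T⟧, kernel re-lan -/
@[route_item "route-BirchSwinnertonDyer-CumulativeHeegnerLeopoldt", crux]
def WildSplitFrameAtThree : Prop :=
  ∀ (W : WeierstrassCurve ℚ) [W.IsElliptic] [W.IsGloballyMinimal] (N : ℕ) [NeZero N] (K : Type) [Field K] [NumberField K] (Dt : Literature.NumberTheory.EllipticCurves.ModularForms.ModularParametrizationData W N), Summit.BirchSwinnertonDyer.Rank1Residual.Additive.ClassO6 W 3 → W.conductorNorm ℤ = N → Literature.NumberTheory.EllipticCurves.IsImaginaryQuadratic K → Literature.NumberTheory.EllipticCurves.SatisfiesHeegnerHypothesis N K → ∀ (κ : Literature.NumberTheory.EllipticCurves.ZpExtension K 3), κ.IsAnticyclotomic → ∀ (γ : Field.absoluteGaloisGroup K) [Fact (κ.IsTopGenerator γ)] (𝔭 : IsDedekindDomain.HeightOneSpectrum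 (NumberField.RingOfIntegers K)), ((3 : ℕ) : NumberField.RingOfIntegers K) ∈ 𝔭.asIdeal → ∃ ι' : PadicAlgCl 3 ≃+* ℂ, Summit.BirchSwinnertonDyer.BirchSwinnertonDyer.Theorems.SchneiderFree.BranchInducesPrime 3 ι' 𝔭 ∧ ∃ (ΩK : ℂ) (Ωp : ℂ_[3]) (L : Literature.NumberTheory.EllipticCurves.UnrSeries 3), ΩK ≠ 0 ∧ Ωp ≠ 0 ∧ Literature.NumberTheory.EllipticCurves.IsBDPLFunction ι' 𝔭 κ γ Dt.f ΩK Ωp L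

/-- item stmt-BirchSwinnertonDyer-20316 · support · rank 9 · open · by planner
sources: LiuZhangZhang2018
[support] Published input BY NAME (pattern β, director-bsd GO-β-W 2026-08-27T10:29:03Z):
Liu–Zhang–Zhang, Duke Math. J. 167 (2018) Thm 1.5.1 ∧ Thm 1.5.3 read at an additive prime (p-adic
Waldspurger formula on the modular curve + non-vanishing of the Heegner vector); typed fact
`Literature.NumberTheory.EllipticCurves.LiuZhangZhang2018.thm151_thm153_modularCurve_heegnerVector_additive`
(p518041, reviewed). Consumed by KatzWaldspurgerFrameCMInertBadFlatOfLZZ in closes. Why it might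
fail: only if the typed additive reading over-states Thm 1.5.3 (ε-factor / level hypotheses at the
additive place). Sources: doi:10.1215/00127094-2017-0045, arXiv:1511.08172, arXiv:1408.1733. -/
@[route_item "route-BirchSwinnertonDyer-CumulativeHeegnerLeopoldt", crux]
def LiuZhangZhangAdditiveInput : Prop :=
  Literature.NumberTheory.EllipticCurves.LiuZhangZhang2018.thm151_thm153_modularCurve_heegnerVector_additive

/-- item stmt-BirchSwinnertonDyer-20389 · support · rank 9 · SPLIT (gen 1) into RankEqAnalyticRankLeOne, EntireLFunctionRat, ModularParametrizationSupply, BSDQuotientIsogenyInvariance, GrossZagierRationalPointI73, FriedbergHoffsteinHeegnerSplitDivisorsTwist, ToricParametrisedInputs + glue ToricPublishedInputsGlue · direct attempts still welcome (low priority) · by planner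
sources: GrossZagier1986, Kolyvagin1990, FriedbergHoffstein1995
[support] The published inputs the kernel consumes, by name: Gross–Zagier, Kolyvagin,
Gross–Zagier–Kolyvagin rank theorem, modularity, a parametrisation datum, BSD-quotient isogeny
invariance, GZ86 I.(7.3), Friedberg–Hoffstein Thm B with prescribed splitting at the divisors of
N(E) and of M = N(E′), parity, Heegner points over K. [difficulty: provable-now] -/
@[route_item "route-BirchSwinnertonDyer-CumulativeHeegnerLeopoldt", crux]
def ToricPublishedInputs : Prop :=
  (∀ (N : ℕ) [NeZero N] (W : WeierstrassCurve ℚ) (K : Type) [Field K] [NumberField K], Literature.NumberTheory.EllipticCurves.gross_zagier N W K) ∧ (∀ (N : ℕ) [NeZero N] (W : WeierstrassCurve ℚ) (K : Type) [Field K] [NumberField K], Literature.NumberTheory.EllipticCurves.kolyvagin N W K) ∧ Literature.NumberTheory.EllipticCurves.rank_eq_analyticRank_of_analyticRank_le_one ∧ WeierstrassCurve.hasEntireLFunction_rat ∧ Literature.NumberTheory.EllipticCurves.ModularForms.nonempty_modularParametrizationData ∧ WeierstrassCurve.bsdRHS_eq_of_isIsogenous ∧ Literature.NumberTheory.EllipticCurves.GrossZagier1986_thm_I_7_3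 ∧ Literature.NumberTheory.EllipticCurves.friedbergHoffstein_exists_heegnerField_splitDivisors_twist_ne_zero ∧ (∀ (W : WeierstrassCurve ℚ), Literature.NumberTheory.EllipticCurves.even_analyticRank_iff_rootNumber_eq_one W) ∧ (∀ (W : WeierstrassCurve ℚ) (K : Type) [Field K] [NumberField K], Literature.NumberTheory.EllipticCurves.exists_isHeegnerPoint W K)

-- parent: ToricPublishedInputs · child (gen 1)
/--     item stmt-BirchSwinnertonDyer-19921 · support · rank 901 · open
    parent: ToricPublishedInputs · by operator
    sources: GrossZagier1986, Kolyvagin1990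
[support] The one PUBLISHED input the halves-glue consumes: Gross–Zagier–Kolyvagin, rank = analytic
rank for analytic rank ≤ 1 with Ш finite (tree named fact
rank_eq_analyticRank_of_analyticRank_le_one; used by bsdp_of_missingPPartAt to turn Miller's last
clause into BSD(E,2)). Carried as a displayed PUB hypothesis; never counted as progress. The further
PRINT of the roads to the two halves (Greenberg Thm-4.1 analogues at a multiplicative prime
thm41Analogue_charValue_rankZero_numberField_anyPrime / …_split_baseChange_anyPrime, modularity) and
the referee-passed MEMO inputs (Kato ⊗ℚ at a multiplicative 2:
X5.O1.KatoMultiplicativeDivisibilityRat W 2, HOME mult/PROOF-MULT.md RC-2; Greenberg–Stevens at 2: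
greenberg_stevens W 2, mult/PROOF-GS2.md RC-4) enter the LINES under the halves (bridge
multiplicativeRankZeroAtTwo_of_muRoad, p409679), not this glue. -/
@[route_item "route-BirchSwinnertonDyer-CumulativeHeegnerLeopoldt"]
def RankEqAnalyticRankLeOne : Prop :=
  Literature.NumberTheory.EllipticCurves.rank_eq_analyticRank_of_analyticRank_le_one

-- parent: ToricPublishedInputs · child (gen 1)
/--     item stmt-BirchSwinnertonDyer-19273 · support · rank 902 · open
    parent: ToricPublishedInputs · by planner
    sources: BreuilConradDiamondTaylor2001
[support] entire continuation of L(E/ℚ, s) (modularity: Breuil–Conrad–Diamond–Taylor 2001 Thm A +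
Hecke/Shimura), BY NAME — conjunct of MultConversePublishedInputsAtTwo (19185); same content, filed
so the head constant is item-stated (#15c one rule; cite_only dep) -/
@[route_item "route-BirchSwinnertonDyer-CumulativeHeegnerLeopoldt"]
def EntireLFunctionRat : Prop :=
  WeierstrassCurve.hasEntireLFunction_rat

-- parent: ToricPublishedInputs · child (gen 1)
/--     item stmt-BirchSwinnertonDyer-19266 · support · rank 903 · open
    parent: ToricPublishedInputs · by planner
    sources: BreuilConradDiamondTaylor2001
[support] modularity of E/ℚ as parametrisation data (Breuil–Conrad–Diamond–Taylor 2001 Thm A), BY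
NAME — conjunct of OrdPublishedInputsAtTwo (19149; Literature.Uncategorized.OrdPublishedInputsAtTwo
l.26); same content, filed so the head constant is item-stated (#15c one rule; cite_only dep) -/
@[route_item "route-BirchSwinnertonDyer-CumulativeHeegnerLeopoldt"]
def ModularParametrizationSupply : Prop :=
  Literature.NumberTheory.EllipticCurves.ModularForms.nonempty_modularParametrizationData

-- parent: ToricPublishedInputs · child (gen 1)
/--     item stmt-BirchSwinnertonDyer-19307 · support · rank 904 · open
    parent: ToricPublishedInputs · by operator
    sources: Cassels1965, Milne1986ADT
[support] Cassels 1965 (Arithmetic on curves of genus 1, VIII; J. reine angew. Math. 217) / Milne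
ADT Thm I.7.3 and Rem I.7.4: the BSD quotient (right-hand side of the BSD formula) is invariant
under isogeny over ℚ — conjunct of the support PrintedFacts (stmt-BirchSwinnertonDyer-19362), BY
NAME; same content, filed as a split child so the head constant is item-stated (gate5 #15c one rule;
readiness rule 2026-08-15: cite_only dep declared by the route; director-bsd 2026-08-26T04:22Z
«K3/E2 shape»); no crux statement / closes / tribunal change -/
@[route_item "route-BirchSwinnertonDyer-CumulativeHeegnerLeopoldt"]
def BSDQuotientIsogenyInvariance : Prop :=
  WeierstrassCurve.bsdRHS_eq_of_isIsogenous

-- parent: ToricPublishedInputs · child (gen 1)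
/--     item stmt-BirchSwinnertonDyer-19369 · support · rank 905 · open
    parent: ToricPublishedInputs · by planner
    sources: GrossZagier1986
[aside] Gross–Zagier 1986 Thm. I.(7.3) (p. 231; proof V.§2 pp. 310–313): L′(E,1) ≠ 0 ⇒ a rational
point of infinite order (via a Heegner point and the GZ formula) — a cite_only dep of this route
reached through the depth-1 support item PublishedInputsIMCReduction
(stmt-BirchSwinnertonDyer-19283, child of 19061; a third item layer is forbidden, so it is
item-stated here as a by-name ASIDE: banked context, never staffed, BC6-exempt; gate5 02:15:40Z
«aside also counts»); no crux statement / closes / tribunal change -/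
@[route_item "route-BirchSwinnertonDyer-CumulativeHeegnerLeopoldt"]
def GrossZagierRationalPointI73 : Prop :=
  Literature.NumberTheory.EllipticCurves.GrossZagier1986_thm_I_7_3

-- parent: ToricPublishedInputs · child (gen 1)
/--     item stmt-BirchSwinnertonDyer-19449 · support · rank 906 · open
    parent: ToricPublishedInputs · by planner
    sources: FriedbergHoffstein1995
[aside] Friedberg–Hoffstein 1995 Thm. B (special case; with Waldspurger / Bump–Friedberg–Hoffstein):
a Heegner field K for N with prescribed primes SPLIT and L(E^{d_K},1) ≠ 0 (used by HeegnerTwistData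
19183 to supply the B6 Heegner datum at an additive p) — a cite_only dep of this route
(deps.unproved, rev 6), item-stated here as a BY-NAME ASIDE so the route's dependency cone is
declared (gate5 02:15:40Z «aside also counts»; ErratumRoadFive 19369–19375 / K1 19303–19307
precedent): banked context, never staffed, BC6-exempt, closes only by formalisation; no crux
statement / closes / tribunal / tribunal_fit change. Filed by the route base unit P2 g8 for
STAFFABLE (director-bsd 04:57:54Z E2). sources: FriedbergHoffstein1995, JetchevSkinnerWan2017 §7.4.1 -/
@[route_item "route-BirchSwinnertonDyer-CumulativeHeegnerLeopoldt"]
def FriedbergHoffsteinHeegnerSplitDivisorsTwist : Prop :=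
  Literature.NumberTheory.EllipticCurves.friedbergHoffstein_exists_heegnerField_splitDivisors_twist_ne_zero

-- parent: ToricPublishedInputs · child (gen 1)
/--     item stmt-BirchSwinnertonDyer-20428 · support · rank 907 · open
    parent: ToricPublishedInputs · by planner
    sources: GrossZagier1986, Kolyvagin1990, JetchevSkinnerWan2017
[support, PUB parametrised] the four parametrised published inputs (Gross–Zagier, Kolyvagin, parity,
Heegner points over K) the kernel consumes at the chosen (N, W, K). -/
@[route_item "route-BirchSwinnertonDyer-CumulativeHeegnerLeopoldt"]
def ToricParametrisedInputs : Prop :=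
  (∀ (N : ℕ) [NeZero N] (W : WeierstrassCurve ℚ) (K : Type) [Field K] [NumberField K], Literature.NumberTheory.EllipticCurves.gross_zagier N W K) ∧ (∀ (N : ℕ) [NeZero N] (W : WeierstrassCurve ℚ) (K : Type) [Field K] [NumberField K], Literature.NumberTheory.EllipticCurves.kolyvagin N W K) ∧ (∀ (W : WeierstrassCurve ℚ), Literature.NumberTheory.EllipticCurves.even_analyticRank_iff_rootNumber_eq_one W) ∧ (∀ (W : WeierstrassCurve ℚ) (K : Type) [Field K] [NumberField K], Literature.NumberTheory.EllipticCurves.exists_isHeegnerPoint W K)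

-- parent: ToricPublishedInputs · glue (gen 1)
/--     item stmt-BirchSwinnertonDyer-24222 · support · rank 908 · closed · proved by Summit.BirchSwinnertonDyer.BirchSwinnertonDyer.Theorems.toricPublishedInputsGlue_proof (prover)
    parent: ToricPublishedInputs · GLUE: children ⟹ parent · by planner
published inputs by name: the conjunction is re-assembled from its seven by-name parts (identical to
UniversalToricDescent's split of the shared item 20389; glue proved there by
toricPublishedInputsGlue_proof) -/
@[route_item "route-BirchSwinnertonDyer-CumulativeHeegnerLeopoldt"]
def ToricPublishedInputsGlue : Prop :=
  RankEqAnalyticRankLeOne → EntireLFunctionRat → ModularParametrizationSupply → BSDQuotientIsogenyInvariance → GrossZagierRationalPointI73 → FriedbergHoffsteinHeegnerSplitDivisorsTwist → ToricParametrisedInputs → ToricPublishedInputs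

/-- `ToricPublishedInputsGlue` holds: proved by `Summit.BirchSwinnertonDyer.BirchSwinnertonDyer.Theorems.toricPublishedInputsGlue_proof`. -/
theorem ToricPublishedInputsGlue_holds : ToricPublishedInputsGlue := _root_.Summit.BirchSwinnertonDyer.BirchSwinnertonDyer.Theorems.toricPublishedInputsGlue_proof

/-- item stmt-BirchSwinnertonDyer-24476 · support · rank 9 · open · by planner
sources: Hsieh2014, BertoliniDarmonPrasanna2013, LiuZhangZhang2018
[support, by-name PACKAGE of the refereed inputs of crux #4♯ — exists because `closes` may bind only
TOP-LEVEL items (pattern of 23651 / 20692)] Hsieh 2014 Thm A any level (alias HsiehAnyLevelInput) ∧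
BDP13 Thm 5.5 (alias BDPCentralValueReciprocityInput) ∧ Liu–Zhang–Zhang 2018 Thm 1.5.1/1.5.3
additive (item 20316 `LiuZhangZhangAdditiveInput`, shared with BiquadraticEisensteinDescent;
p518041). Consumed by ToricKernelAtThreeApZeroOdd; a displayed hypothesis of `closes` — the route
closes MODULO these printed inputs exactly as it already did modulo LZZ through 20385's split glue
(20929). Closes only by formalisation of the three facts (`⟨h₁, h₂, h₃⟩`); nobody should staff it. -/
@[route_item "route-BirchSwinnertonDyer-CumulativeHeegnerLeopoldt", crux]
def WildSplitPrintedInputsAtThree : Prop :=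
  Literature.NumberTheory.EllipticCurves.Hsieh2014.thmA_exists_isHsiehLFunction_unrPeriod_anyLevel ∧ Literature.NumberTheory.EllipticCurves.bertoliniDarmonPrasanna2013_centralValue_reciprocity ∧ LiuZhangZhangAdditiveInput

/-- item stmt-BirchSwinnertonDyer-23971 · support · rank 9 · closed · proved by Summit.BirchSwinnertonDyer.BirchSwinnertonDyer.Theorems.cumulativeHeegnerLeopoldt_leopoldtKernelAtThreeOfPrintOdd_proof (prover) · by planner
sources: JetchevSkinnerWan2017, Hsieh2014, BertoliniDarmonPrasanna2013, LiuZhangZhang2018, GrossZagier1986, CastellaGrossiSkinner2025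
[support, kernel♯ at ODD d_K — rev 7] Item 25837 `LeopoldtKernelAtThreeOfPrint` (CLOSED,
`cumulativeHeegnerLeopoldt_leopoldtKernelAtThreeOfPrint_proof`) with its K2 antecedent
`EisensteinCharacterInvariantsAtThree →` replaced VERBATIM by
`EisensteinCharacterInvariantsAtThreeOdd →`: published inputs → LZZ → K1 → K2-odd → print frame
package → K4 → K5 → BSD₃(E) for every globally minimal NON-CM E on ClassO6 at 3 with r_an = 1, E[3]
reducible and a non-anomalous rational line. PROVABLE NOW (mechanical): closer =
Theorems/…LeopoldtKernelAtThreeOfPrint.lean (292 l.) with ONE token changed — l.169 `h2 W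
(W.conductorNorm ℤ) K Dt hO6 hRed hcell hr rfl hK hHN hodd κ …`, `hodd : Odd (NumberField.discr K)`
being already derived at l.97–101 from Friedberg–Hoffstein with auxiliary modulus 2 — followed by
the one-line `theorem … : LeopoldtKernelAtThreeOfPrintOdd := fun hF hL h1 h2 hW h4 h5 W _ _ hCM hO6
hr hRed hcell => …` (K2 lead chl-p1 lineage, after this rev renders the decl). Supersedes 25837 on
the deciding chain (25837 and 24199 → aside by the same edit; neither reworded). Pen scratch
chl/scratch-rev7.lean (local copies + the rev-7 `closes`): lean check rc 0, 0 sorries. [difficulty: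
prova -/
@[route_item "route-BirchSwinnertonDyer-CumulativeHeegnerLeopoldt", crux]
def LeopoldtKernelAtThreeOfPrintOdd : Prop :=
  ToricPublishedInputs → LiuZhangZhangAdditiveInput → CumulativeHeegnerInclusionAtThree → EisensteinCharacterInvariantsAtThreeOdd → WildSplitPrintedInputsAtThree → RedSplitControlAtThree → WildRankZeroTwistAtThree → ∀ (W : WeierstrassCurve ℚ) [W.IsElliptic] [W.IsGloballyMinimal], ¬ W.HasCM → Summit.BirchSwinnertonDyer.Rank1Residual.Additive.ClassO6 W 3 → W.analyticRank = 1 → Literature.NumberTheory.EllipticCurves.Rank1Residual.Red W 3 → (∃ Φ : AddSubgroup (WeierstrassCurve.geomTorsion W ((3 : ℕ) : ℤ)), Literature.NumberTheory.EllipticCurves.Rank1Residual.IsRationalLine W 3 Φ ∧ ∀ (v : IsDedekindDomain.HeightOneSpectrum (NumberField.RingOfIntegers ℚ)), ((3 : ℕ) : NumberField.RingOfIntegers ℚ) ∈ v.asIdeal → ∀ 𝔓 ∈ v.primesAbove, ¬ (∀ g ∈ 𝔓.decompositionSubgroup (Field.absoluteGaloisGroup ℚ), ∀ P ∈ Φ,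 g • P = P) ∧ ¬ (∀ g ∈ 𝔓.decompositionSubgroup (Field.absoluteGaloisGroup ℚ), ∀ P : WeierstrassCurve.geomTorsion W ((3 : ℕ) : ℤ), g • P - P ∈ Φ)) → Literature.NumberTheory.EllipticCurves.BSDp W 3

-- `LeopoldtKernelAtThreeOfPrintOdd` holds: proved by `Summit.BirchSwinnertonDyer.BirchSwinnertonDyer.Theorems.cumulativeHeegnerLeopoldt_leopoldtKernelAtThreeOfPrintOdd_proof` (its module imports this route file, so no `_holds` link can be stated here).

-- earlier LeopoldtKernelAtThree (stmt-BirchSwinnertonDyer-24202, replaced 2026-08-28T02:33:35Z -> stmt-BirchSwinnertonDyer-24865): retired by None — ToricPublishedInputs → LiuZhangZhangAdditiveInput → CumulativeHeegnerInclusionAtThree → EisensteinCharacterInvariantsAtThree → WildSplitFrameAtThree → RedSplitControlAtThree → WildRankZeroTwistAtThree → ∀ (W : WeierstrassCurve ℚ) [W.IsElliptic] [W.IsGlo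
/-- item stmt-BirchSwinnertonDyer-24865 · aside · rank 9 · closed · proved by Summit.BirchSwinnertonDyer.BirchSwinnertonDyer.Theorems.cumulativeHeegnerLeopoldt_leopoldtKernelAtThree_proof (prover) · by operator
sources: GrossZagier1986, CastellaGrossiSkinner2025, LiuZhangZhang2018
[support] The kernel on the Leopoldt cell: published inputs → LZZ → K1 → K2 → K3 → K4 → K5 → BSD₃(E)
for every wild-3, r_an = 1, E[3]-reducible E on the cell. Proof plan = the
SemiOrdinaryEisensteinDescent kernel verbatim with the image swapped: K1 + frame + LZZ value
(`wildSplitWaldspurgerAtThree_flat_forall`, image-free) + control ⇒ 2·ord₃[E(K):ℤy_K] ≥ ord₃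
#Ш(E/K)·(index data) (upper bound on Ш); K2 turns the inclusion into equality of ideals (same λ, μ =
0 ⇒ unit quotient) ⇒ the reverse inequality; exact index + Gross–Zagier + partner BSD₃(E^K) (K5) ⇒
BSD₃(E) by `bsdp_of_exactIndexManin_of_partner_bsdp` (any odd p ∣ N, image-free). [difficulty: L] -/
@[route_item "route-BirchSwinnertonDyer-CumulativeHeegnerLeopoldt"]
def LeopoldtKernelAtThree : Prop :=
  ToricPublishedInputs → LiuZhangZhangAdditiveInput → CumulativeHeegnerInclusionAtThree → EisensteinCharacterInvariantsAtThree → WildSplitFrameAtThree → RedSplitControlAtThree → WildRankZeroTwistAtThree → ∀ (W : WeierstrassCurve ℚ) [W.IsElliptic] [W.IsGloballyMinimal], ¬ W.HasCM → Summit.BirchSwinnertonDyer.Rank1Residual.Additive.ClassO6 W 3 → W.analyticRank = 1 → Literature.NumberTheory.EllipticCurves.Rank1Residual.Red W 3 → (∃ Φ : AddSubgroup (WeierstrassCurve.geomTorsion W ((3 : ℕ) : ℤ)), Literature.NumberTheory.EllipticCurves.Rank1Residual.IsRationalLine W 3 Φ ∧ ∀ (v : IsDedekindDomain.HeightOneSpectrum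 (NumberField.RingOfIntegers ℚ)), ((3 : ℕ) : NumberField.RingOfIntegers ℚ) ∈ v.asIdeal → ∀ 𝔓 ∈ v.primesAbove, ¬ (∀ g ∈ 𝔓.decompositionSubgroup (Field.absoluteGaloisGroup ℚ), ∀ P ∈ Φ, g • P = P) ∧ ¬ (∀ g ∈ 𝔓.decompositionSubgroup (Field.absoluteGaloisGroup ℚ), ∀ P : WeierstrassCurve.geomTorsion W ((3 : ℕ) : ℤ), g • P - P ∈ Φ)) → Literature.NumberTheory.EllipticCurves.BSDp W 3

-- `LeopoldtKernelAtThree` holds: proved by `Summit.BirchSwinnertonDyer.BirchSwinnertonDyer.Theorems.cumulativeHeegnerLeopoldt_leopoldtKernelAtThree_proof` (its module imports this route file, so no `_holds` link can be stated here).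

/-- item stmt-BirchSwinnertonDyer-25837 · aside · rank 9 · closed · proved by Summit.BirchSwinnertonDyer.BirchSwinnertonDyer.Theorems.cumulativeHeegnerLeopoldt_leopoldtKernelAtThreeOfPrint_proof (prover) · by planner
sources: JetchevSkinnerWan2017, Hsieh2014, BertoliniDarmonPrasanna2013, LiuZhangZhang2018, GrossZagier1986, CastellaGrossiSkinner2025
[support] kernel♯ on the Leopoldt cell = item 24865 `LeopoldtKernelAtThree` (CLOSED·proved p598550)
with its K3 antecedent `WildSplitFrameAtThree →` (20928, the ∀-K research form, even d_K included)
replaced VERBATIM by the print package `WildSplitPrintedInputsAtThree →`: published inputs → LZZ →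
K1 → K2 → print → K4 → K5 → BSD₃(E) for every globally minimal NON-CM E on ClassO6 at 3 with r_an =
1, E[3] reducible and a non-anomalous rational line. PROVABLE NOW modulo gate acceptance of p599932
(utd-p3 g8, Theorems/CumulativeHeegnerLeopoldtLeopoldtKernelAtThreeOfPrint.lean:
`leopoldtKernelAtThree_of_not_hasCM_of_printedInputs`, K3 at odd d_K discharged by the tree theorem
`wildSplitFrameAtThreeOddOfPrint_proof` p596578): closer = ONE-LINE Theorems file `theorem … :
LeopoldtKernelAtThreeOfPrint := fun hF hL h1 h2 hW h4 h5 W _ _ hCM hO6 hr hRed hcell =>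
leopoldtKernelAtThree_of_not_hasCM_of_printedInputs hF hL h1 h2 hW h4 h5 W hCM hO6 hr hRed hcell`
(δ-unfolds across the two routes' copies of the print decl, Iff.rfl checked in the pen's preview
be8a400e959f8688). Supersedes 24865 on the deciding chain (24865 and 20928 → aside by the follow-up
retriage; neither is reworded). TURNKEY-CHL -/
@[route_item "route-BirchSwinnertonDyer-CumulativeHeegnerLeopoldt"]
def LeopoldtKernelAtThreeOfPrint : Prop :=
  ToricPublishedInputs → LiuZhangZhangAdditiveInput → CumulativeHeegnerInclusionAtThree → EisensteinCharacterInvariantsAtThree → WildSplitPrintedInputsAtThree → RedSplitControlAtThree → WildRankZeroTwistAtThree → ∀ (W : WeierstrassCurve ℚ) [W.IsElliptic] [W.IsGloballyMinimal], ¬ W.HasCM → Summit.BirchSwinnertonDyer.Rank1Residual.Additive.ClassO6 W 3 → W.analyticRank = 1 → Literature.NumberTheory.EllipticCurves.Rank1Residual.Red W 3 → (∃ Φ : AddSubgroup (WeierstrassCurve.geomTorsion W ((3 : ℕ) : ℤ)), Literature.NumberTheory.EllipticCurves.Rank1Residual.IsRationalLine W 3 Φ ∧ ∀ (v : IsDedekindDomain.HeightOneSpectrum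 (NumberField.RingOfIntegers ℚ)), ((3 : ℕ) : NumberField.RingOfIntegers ℚ) ∈ v.asIdeal → ∀ 𝔓 ∈ v.primesAbove, ¬ (∀ g ∈ 𝔓.decompositionSubgroup (Field.absoluteGaloisGroup ℚ), ∀ P ∈ Φ, g • P = P) ∧ ¬ (∀ g ∈ 𝔓.decompositionSubgroup (Field.absoluteGaloisGroup ℚ), ∀ P : WeierstrassCurve.geomTorsion W ((3 : ℕ) : ℤ), g • P - P ∈ Φ)) → Literature.NumberTheory.EllipticCurves.BSDp W 3

-- `LeopoldtKernelAtThreeOfPrint` holds: proved by `Summit.BirchSwinnertonDyer.BirchSwinnertonDyer.Theorems.cumulativeHeegnerLeopoldt_leopoldtKernelAtThreeOfPrint_proof` (its module imports this route file, so no `_holds` link can be stated here).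

/-- item stmt-BirchSwinnertonDyer-24203 · assembly · rank 1 · closed · proved by Summit.BirchSwinnertonDyer.BirchSwinnertonDyer.Theorems.cumulativeHeegnerLeopoldt_assembly_proof (prover) · by planner
sources: GrossZagier1986
[assembly] ToricPublishedInputs → LiuZhangZhangAdditiveInput → K1 → K2 → K3 → K4 → K5 → K6 →
LeopoldtKernelAtThree → the leaf WAllExclAddWildRankOne. -/
@[route_item "route-BirchSwinnertonDyer-CumulativeHeegnerLeopoldt"]
def Assembly : Prop :=
  ToricPublishedInputs → LiuZhangZhangAdditiveInput → CumulativeHeegnerInclusionAtThree → EisensteinCharacterInvariantsAtThree → WildSplitFrameAtThree → RedSplitControlAtThree → WildRankZeroTwistAtThree → WildRankOneOffLeopoldtCellAtThree → LeopoldtKernelAtThree → Summit.BirchSwinnertonDyer.WAllExclAddWildRankOne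

-- `Assembly` holds: proved by `Summit.BirchSwinnertonDyer.BirchSwinnertonDyer.Theorems.cumulativeHeegnerLeopoldt_assembly_proof` (its module imports this route file, so no `_holds` link can be stated here).

/-! D-0027 §2.1 — DECIDING THEOREM (planner-authored via `route open/edit --closes-file`; by planner-bsd-wall-pss3-g21-0 2026-08-29T01:47:10Z):
its hypotheses are this route's items and its conclusion the registered leaf `Summit.BirchSwinnertonDyer.WAllExclAddWildRankOne` (rung W-ALL/2@3.WildRankOne, D-0061) (glue_lint), and it elaborates with this file. -/

/-- The deciding theorem (rev 7, kernel♯ at ODD d_K — K2-ODD CUT, pen pss3 g21 on the K2 lead chl-p1 g9's restate datum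
00:58:20Z): as rev 3, with the Eisenstein character comparison consumed in its ODD-DISCRIMINANT form
`EisensteinCharacterInvariantsAtThreeOdd` (binder `Odd (NumberField.discr K)` inserted after the Heegner hypothesis —
every typed print input of the K2 line carries it, and the kernel applies K2 only at its own Friedberg–Hoffstein field
with auxiliary modulus 2, where d_K is odd: Theorems/…LeopoldtKernelAtThreeOfPrint.lean l.97–101 before l.169) through
the kernel item `LeopoldtKernelAtThreeOfPrintOdd` (= 25837 with K2 ↦ K2-odd, one token in the proof); the ∀-d_K form
24199 and the rev-3 kernel 25837 are kept as banked asides (K2 → K2-odd trivially; every landed consumer of 24199 stays a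
theorem). A wild rank-one row either lies on the Leopoldt cell, closed by the kernel from the published inputs, LZZ, K1,
K2-odd, the PRINTED frame package, control K4 and the rank-zero twist partner K5 — or off it, the declared residual K6. -/
@[closes "route-BirchSwinnertonDyer-CumulativeHeegnerLeopoldt"] theorem closes (hF : ToricPublishedInputs) (hL : LiuZhangZhangAdditiveInput)
    (h1 : CumulativeHeegnerInclusionAtThree) (h2 : EisensteinCharacterInvariantsAtThreeOdd)
    (hW : WildSplitPrintedInputsAtThree) (h4 : RedSplitControlAtThree) (h5 : WildRankZeroTwistAtThree)
    (h6 : WildRankOneOffLeopoldtCellAtThree) (hK : LeopoldtKernelAtThreeOfPrintOdd) :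
    Summit.BirchSwinnertonDyer.WAllExclAddWildRankOne := by
  intro W _ _ hCM hO6 hr
  by_cases hcell : (Literature.NumberTheory.EllipticCurves.Rank1Residual.Red W 3 ∧ (∃ Φ : AddSubgroup (WeierstrassCurve.geomTorsion W ((3 : ℕ) : ℤ)), Literature.NumberTheory.EllipticCurves.Rank1Residual.IsRationalLine W 3 Φ ∧ ∀ (v : IsDedekindDomain.HeightOneSpectrum (NumberField.RingOfIntegers ℚ)), ((3 : ℕ) : NumberField.RingOfIntegers ℚ) ∈ v.asIdeal → ∀ 𝔓 ∈ v.primesAbove, ¬ (∀ g ∈ 𝔓.decompositionSubgroup (Field.absoluteGaloisGroup ℚ), ∀ P ∈ Φ, g • P = P) ∧ ¬ (∀ g ∈ 𝔓.decompositionSubgroup (Field.absoluteGaloisGroup ℚ), ∀ P : WeierstrassCurve.geomTorsion W ((3 : ℕ) : ℤ), g • P - P ∈ Φ)))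
  · exact hK hF hL h1 h2 hW h4 h5 W hCM hO6 hr hcell.1 hcell.2
  · exact h6 W hCM hO6 hr hcell

end Summit.BirchSwinnertonDyer.BirchSwinnertonDyer.Theses.CumulativeHeegnerLeopoldt
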